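import Literature.MathematicalPhysics.QuantumFieldTheory.Dimock2011to13.Reblocking
import Literature.MathematicalPhysics.QuantumFieldTheory.Dimock2011to13.ConnectedPolymerSums

/-!
# Dimock, *The renormalization group according to Balaban* I, §4.5 LEMMA 19 (`\label{snort}`): the summation
# (tuna) → (tuna2) → (stinger) ASSEMBLED, and II, §3.13 LEMMA 3.15 (`\label{first}`) step (F): (stovepipe) →
# (snuffit) PROVED — the decay of the localized pieces survives the decoupling sums, on the cell's periodic polymer
# model (LEMMA 20, (sudsy), (ninety), LEMMA 10's coarsening and App. D LEMMA D.2 BY NAME), every «M sufficiently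
# large» clause explicit

**Citation header (reproduction of PUBLISHED work; template of the Bałaban lattice Yang–Mills cell).**
J. Dimock, *The renormalization group according to Balaban I. Small fields*, Rev. Math. Phys. **25** (2013) 1330010
(= arXiv:1108.1335v2) [Dimock2013], §4.5 `\subsection{localization}` (TeX L2341): the expansion (summer) L2382–2390, the
re-summation L2391–2395 and (newloc) L2396–2398, LEMMA 18 (unlabelled, L2403–2404), LEMMA 19 `\label{snort}` with
(stinger) L2432–2437 and its proof L2445–2473 — (unsung2) L2450, the Cauchy bound L2453–2458, (tuna) L2459–2464, the
extraction sentence L2465–2467, (tuna2) L2468–2470, the closing L2471–2473 — and LEMMA 20 (salsa) L2476–2492 (the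
source's global counter `\newtheorem{lem}[thm]`: #18 L2403, #19 = `snort`, #20 = the (salsa) lemma).  J. Dimock, *The
renormalization group according to Balaban II. Large fields*, J. Math. Phys. **54** (2013) 092301 (= arXiv:1212.5562v2)
[Dimock2013BalabanII], §3.13 `\subsection{localization}` L4445, LEMMA 3.15 `\label{first}` L4456–4482, proof steps (A)
L4498–4535 ((twinkie) L4530), (B) L4537–4590 ((gong) L4554, (stingy2) L4562, (arson2) L4582, (arson1) L4587), (C)
L4593–4615, (D) L4618–4649, (E) L4652–4663, **(F) L4665–4722** ((stovepipe) L4693, (snuffit) L4717), (G) L4725, (H)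
L4740; App. D LEMMA D.2 `\label{donut2}` L6727.  TeX line numbers refer to the arXiv sources held by the cell
(`inputs/files/dimock/src/1108.1335/1108.1335.tex`, 4263 lines, sha256[:16] 7382e6540dded9be;
`inputs/files/dimock/src/1212.5562/1212.5562.tex`, 7217 lines, sha256[:16] 75c5792fc48eacbc); every quotation below was
read there this session.  Dimock's papers are published and refereed and are the cell's TEMPLATE, not manuscripts
under audit; no quantity of the Bałaban series is touched.

**What the papers print (verbatim, TeX → Unicode; `…` marks an elision).**  PART I.  (newloc) L2391–2400: *"Now we write
δE_k^+ = Σ_Y (δE_k^+)′(Y) = Σ_Y Σ_{Z⊃Y} δE_k^+(Y,Z) = Σ_Z (δE^+_k)^{loc}(Z) where (δE^+_k)^{loc}(Z) = Σ_{Y⊂Z} δE_k^+(Y,Z)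
Here Y is connected but Z may not be."*  LEMMA 19 (L2432–2437): *"For φ ∈ ½ℛ_k and |W| ≤ p_{0,k}  |(δE^+_k)^{loc}(Z, φ,
W)| ≤ 𝒪(1)L³λ_k^{1/4−10ε}e^{−L(κ−2κ_0−2)d_{LM}(Z)}"* (stinger).  Proof, L2453–2473: *"|∂/∂s_{Z−Y}[(δE_k^+)′(Y, φ,
𝒲_k(s))]| ≤ 𝒪(1)L³λ_k^{1/4−10ε}e^{−(κ_1−1)|Z−Y|_{LM}}e^{−κ′d_{LM}(Y)}  We can assume κ_1 − 1 ≥ κ′. Using this, integrating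
over s_{Z−Y} and summing over Y ⊂ Z yields |(δE^+_k)^{loc}(Z, φ, W)| ≤ 𝒪(1)L³λ_k^{1/4−10ε}Σ_{Y⊂Z} e^{−κ′|Z−Y|_{LM} −
κ′d_{LM}(Y)}* (tuna) *We show below that |Z−Y|_{LM} + d_{LM}(Y) ≥ d_{LM}(Z). Then we can extract a factor
e^{−(κ′−κ_0)d_{LM}(Z)} and obtain |(δE^+_k)^{loc}(Z, φ, W)| ≤ 𝒪(1)L³λ_k^{1/4−10ε}e^{−(κ′−κ_0)d_{LM}(Z)}Σ_{Y⊂Z}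
e^{−κ_0 d_{LM}(Y)}* (tuna2) *But the sum is bounded by 𝒪(1)|Z|_{LM} by (sudsy) in the appendix. Furthermore by (ninety)
|Z|_{LM} ≤ 𝒪(1)(d_{LM}(Z) + 1) ≤ 𝒪(1)e^{d_{LM}(Z)}. Since κ′ − κ_0 − 1 ≥ L(κ − 2κ_0 − 2) this gives the result."*  LEMMA 20
(L2476–2480): *"For X, Y ∈ 𝒟_k and X ⊂ Y:  Md_M(Y) ≤ M|Y−X|_M + Md_M(X)"* (salsa).  PART II, step (F) (L4665–4722):
*"We estimate (δE^+_k)^{(iv)}(Z). Collecting all the contributions, and dropping conditions X ⊂ Λ_k and Y_1 ∩ Λ^c_{k+1} ≠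
∅ and we have |(δE^+_k)^{(iv)}(Z)| ≤ 𝒪(1)λ_k^{1/4−10ε} Σ_{Y_2: Ȳ_2=Z} Σ_{Y_1⊂Y_2} Σ_{Y⊂Y_1} Σ_{X: X̄=Y} exp(−(κ_1−1)|Y_2−Y_1|_{𝛀′}
− (κ_1−1)|Y_1−Y|_{𝛀′} − κd_M(X))  Now Md_M(X) ≥ LMd_{LM}(Ȳ) since a tree joining the M cubes in X will also join the LM
cubes in Ȳ ∈ 𝒟⁰_{k+1}. Thus we can extract a factor exp(−L(κ−κ_0)d_{LM}(Ȳ)) leaving exp(−κ_0 d_M(X)). Now |Y_2−Y_1|_{𝛀′} +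
|Y_1−Y|_{𝛀′} = |Y_2−Y|_{𝛀′} ≥ |Y_2−Ȳ|_{𝛀′} ≥ |Z−Ȳ|_{LM}  The last step follows since in passing from Y_2−Ȳ to Z−Ȳ we replace
each elementary 𝒟⁰_{k+1,𝛀′} cube in Y_2−Ȳ by the LM cube containing it, and this cannot increase the number of elementary
cubes. Then we can extract a factor exp(−(κ_1/2−1)|Z−Ȳ|_{LM}) which for M sufficiently large is less than exp(−L(κ−κ_0)|Z−
Ȳ|_{LM}). Now use the inequality from part I: |Z−Ȳ|_{LM} + d_{LM}(Ȳ) ≥ d_{LM}(Z) to dominate the extracted factors by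
exp(−L(κ−κ_0)d_{LM}(Z)). Thus we have |(δE^+_k)^{(iv)}(Z)| ≤ 𝒪(1)λ_k^{1/4−10ε}e^{−L(κ−κ_0)d_{LM}(Z)} Σ_{Y_2: Ȳ_2=Z} Σ_{Y_1⊂Y_2}
Σ_{Y⊂Y_1} Σ_{X: X̄=Y} exp(−½κ_1|Y_2−Y|_{𝛀′} − κ_0 d_M(X))* (stovepipe) *For the sum over Y_1 we drop connectedness conditions
and take Σ_{Y⊂Y_1⊂Y_2} 1 ≤ number of subsets of cubes in Y_2−Y_1 ≤ 2^{|Y_2−Y|_{𝛀′}}  This is absorbed by replacing ½κ_1 by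
¼κ_1 in (stovepipe). Now use Σ_{Y_2⊂Z} Σ_{Y⊂Y_2} ≤ Σ_{Y⊂Z} Σ_{Y_2⊃Y}. Then the sum over Y_2 is estimated by lemma D.2 in
the appendix (here Y, Y_2 are connected and we use LM cubes) Σ_{Y_2⊃Y} e^{−¼κ_1|Y_2−Y|_{𝛀′}} ≤ exp(Ce^{−⅛κ_1}|Y|_{𝛀′}) ≤
exp(Ce^{−⅛κ_1}|Z|_{LM}) ≤ 𝒪(1)e^{d_{LM}(Z)}  The second inequality holds since |Y|_{𝛀′} ≤ L³|Z|_{LM}. In the last step we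
have used the inequality |Z|_{LM} ≤ 𝒪(1)(1 + d_{LM}(Z)) and suppressed the constants by taking M and hence κ_1 large
enough. In the final sum Σ_{Y⊂Z} Σ_{X: X̄=Y} = Σ_{X⊂Z} and Σ_{X⊂Z} e^{−κ_0 d_M(X)} ≤ 𝒪(1)|Z|_M = 𝒪(1)L³|Z|_{LM} ≤ 𝒪(1)L³
(d_{LM}(Z)+1) ≤ 𝒪(1)L³e^{d_{LM}(Z)}  Then taking L(κ−κ_0)−2 ≥ L(κ−κ_0−2) yields |(δE^+_k)^{(iv)}(Z)| ≤ 𝒪(1)L³λ_k^{1/4−10ε}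
e^{−L(κ−κ_0−2)d_{LM}(Z)}"* (snuffit).

**Why this module.**  TEMPLATE.md §4.1 row «D1 §4.5 localization (δE^+)^{loc}(Z) via s_□ outside Y …» has the
kernel objects `PolydiscCauchyBounds` (the Cauchy bounds in the polydisc `|s_□| ≤ e^{κ₁}`, (summer) as a recursion —
its reading (iv) declares *"the 'integrating over s_{Z−Y} and summing over Y ⊂ Z' arithmetic (tuna)–(tuna2) L2460–2473,
which uses (sudsy), (ninety) and LEMMA 20, is not reproduced"*), `DecouplingWeights`, `RandomWalkExpansion`; row «D2
§3.13» has `ActiveBoundaryTerms` (steps (E)–(H) of LEMMA 3.15 as finite-sum bookkeeping, with (snuffit) = its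
HYPOTHESIS `hf`, declared *"(snuffit) itself"* NOT claimed) and `FluctuationShiftBound` v1.1 (step (A)).  The two
missing summations are the same mechanism — the decay in the tree length survives the sums that the decoupling
expansions produce — and every geometric input is ALREADY a theorem of the cell's periodic polymer model: LEMMA 20 =
unit pv22's `TreeLengthTorusTransfer.torusTreeLen_le_card_sdiff_add`, LEMMA 10's *"Md_M(X) ≥ LMd_{LM}(Ȳ)"* =
`TreeLengthTorusTransfer.mul_torusTreeLen_image_le`, (sudsy)∕(summing0) = `Reblocking.sum_domsAt_exp_le`, (ninety) =
`TreeLengthTorus.card_le_torusTreeLen`, *"|Y|_M = L³|Y|_{LM}"* = `Reblocking.card_filter_tcoarse_mem_le`, App. D LEMMA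
D.2 = `ConnectedPolymerSums.donut2_connected`.  This module does the two summations.

**What is reproduced here (kernel-checked, zero `sorry`).**
* Part 0 — tools: **`sum_le_sum_mem`** (the union bound `Σ_{Y} ≤ Σ_{□∈F} Σ_{Y∋□}` for families of cube sets meeting
  `F`), **`norm_integral_unitBox_le`** (a unit-box Bochner integral of a function bounded by `c` has norm `≤ c`),
  **`tuna_term`** (*"We can assume κ_1 − 1 ≥ κ′. Using this, integrating over s_{Z−Y}"*: the (tuna) summand
  `A·e^{−κ′|Z−Y|}·e^{−κ′d(Y)}` from the Cauchy bound `A·e^{−(κ₁−1)|Z−Y|}·e^{−κ′d(Y)}` of `PolydiscCauchyBounds.lemma19_cauchy`).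
* Part 1 — PART I on the `LM`-polymer model `Reblocking.doms d n` of the torus `TPt d n`, every dimension `d`, with
  `κ₀ = κ₀(4·2^d, 2d)`, `K₀ = K₀(4·2^d, 2d)` of `B12TreeDecay`: **`salsa`** (LEMMA 20 BY NAME: `d(Z) ≤ |Z−Y| + d(Y)` for
  polymers `Y ⊆ Z`), **`extract_decay`** (the extraction sentence: `e^{−κ′|Z−Y|}e^{−κ′d(Y)} ≤ e^{−(κ′−κ₀)d(Z)}e^{−κ₀d(Y)}`
  for `0 ≤ κ₀ ≤ κ′`), **`sum_doms_subset_exp_le`** ((sudsy) summed over the sub-polymers of `Z`: `Σ_{Y∈𝒟, Y⊆Z} e^{−κd(Y)}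
  ≤ K₀|Z|`), **`loc`** (= (newloc)), **`sum_sum_supsets_eq_sum_loc`** (the re-summation `Σ_Y Σ_{Z⊇Y} = Σ_Z Σ_{Y⊆Z}`),
  **`sum_loc_eq_sum_doms`** (LEMMA 18's restriction to connected `Z`, GIVEN that `δE(Y,Z)` vanishes for disconnected `Z`
  — LEMMA 18's analytic content is that hypothesis), **`stinger`** (LEMMA 19 ASSEMBLED: `‖δE(Y,Z)‖ ≤ A e^{−κ′|Z−Y|}
  e^{−κ′d(Y)}` on polymers `Y ⊆ Z`, `κ′ ≥ κ₀` ⟹ `‖(δE)^{loc}(Z)‖ ≤ 2^d K₀ A e^{−(κ′−κ₀−4)d(Z)}`), **`stinger_printed`**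
  (`κ′ = L(κ−κ₀−1)`, `L ≥ 4` ⟹ rate `L(κ−2κ₀−2)` as printed).
* Part 2 — PART II step (F) on the two nested tori of `Reblocking` (`M`-cubes `TPt d (L·N′)`, `LM`-cubes `TPt d N′`,
  `X̄ = Reblocking.bar`) with the multiscale middle carrier `𝒟⁰_{k+1,𝛀′}` ABSTRACT — a finite type `C` of elementary
  `𝛀′`-cubes with a symmetric adjacency `R` of degree `≤ Δ` (for LEMMA D.2), its `LM`-blocking `q : C → TPt d N′`, and the
  `𝛀′`-blocking `X ↦ barω X` of the `M`-polymers, subject to `q(barω X) = X̄` and `|barω X| ≤ L^d|X̄|`: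
  **`card_image_sdiff_image_le`** (`|q(Y₂) − q(Y)| ≤ |Y₂ − Y|`), **`card_sdiff_add_card_sdiff`**, **`card_Icc_eq_two_pow`**
  (`#[Y, Y₂] = 2^{|Y₂−Y|}`), **`two_pow_mul_exp_le`** (`2^m e^{−½κ₁m} ≤ e^{−¼κ₁m}` for `log 2 ≤ ¼κ₁`), **`stovepipe_term`**
  ((stovepipe) termwise, *"M sufficiently large"* = `L(κ−κ₀) ≤ ½κ₁ − 1`), **`P2`** (the connected `Y₂` with `Ȳ₂ = Z`),
  **`fSum`** (the collected four-fold sum, indexed by `(Y₂, X, Y₁ ∈ [barω X, Y₂])`), **`sum_Icc_le`** (the `Y₁`-sum),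
  **`fSum_eq`** (the exchange `Σ_{Y₂} Σ_{Y⊂Y₂} = Σ_Y Σ_{Y₂⊃Y}`), **`sum_P2_le`** (the `Y₂`-sum by `donut2_connected` at rate
  `¼κ₁`, clause `log 2 + 2log(Δ+1) ≤ ⅛κ₁`), **`donut_factor_le`** (`exp((Δ+1)e^{−⅛κ₁}|Y|) ≤ e^{1/4}e^{d(Z)}` under the
  suppression clause `(Δ+1)e^{−⅛κ₁}L^d 2^{d+2} ≤ 1`), **`sum_bar_subset_exp_le`** (the final `X`-sum `≤ L^d|Z|K₀`),
  **`snuffit`** (`fSum ≤ 2^d K₀ e^{1/4} L^d e^{−(L(κ−κ₀)−5)d(Z)}`) and **`snuffit_printed`** (`L ≥ 3` ⟹ rate `L(κ−κ₀−2)` as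
  printed — EXACTLY the shape of `ActiveBoundaryTerms`' hypothesis `hf`, rate `a + κ₀ = L(κ−κ₀−2)`).
* Non-vacuity (two closing `example`s): the middle-carrier hypotheses hold for `𝛀′` = all `LM`-cubes (`C = TPt d N′`,
  `q = id`, `barω = bar`); the three «M large» clauses are jointly satisfiable (`d = 3`, `Δ = 6`, `L = 3`, `κ = κ₀`,
  `κ₁ = 80`).

**Readings ∕ divergences (declared).**  (i) CARRIER: the cell's periodic polymer model (`Reblocking`: `𝒟_k` = non-empty
torus-face-connected families of cubes, `d_M` = `torusTreeLen`, `X̄ = bar L N′ X` via unit pv22's `tcoarse`), every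
dimension `d`; [Dimock2013] §3 *"Here the tree is in the continuum torus"*.  (ii) CONSTANTS (as in `Reblocking.norm_reblock_le`,
DIVERGENCE D-pv22.1): the model's volume bound is `|Z| ≤ 2^d(4d(Z)+1) ≤ 2^d e^{4d(Z)}` (for the print's (ninety) `|Z|_{LM}
≤ 9(1+d_{LM}(Z))`, d = 3), whence the rate offsets `4` (Part 1; printed `1`) and `5 = 4 + 1` (Part 2; printed `2`) and the
prefactors `2^d K₀` ∕ `2^d K₀ e^{1/4} L^d` for the print's `𝒪(1)` ∕ `𝒪(1)L³`; the printed shapes hold verbatim for `L ≥ 4`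
(Part 1) ∕ `L ≥ 3` (Part 2) — Dimock: *"L sufficiently large"* throughout.  (iii) THE MIDDLE CARRIER of Part 2 is
abstract: the print's `𝒟⁰_{k+1,𝛀′}` (LM-cubes in `Ω_{k+1}`, the cubes of `𝛀(Λ_k^*)` elsewhere) enters (F) only through
`|·|_{𝛀′}` (= `Finset.card`), connectivity (for LEMMA D.2; print `Δ = 2dL^{d−1}`), the blocking *"the LM cube containing
it"* (= `q`) and the two facts `q(X̄^{𝛀′}) = X̄^{LM}` (every `𝛀′`-cube meeting `X ⊂ Λ_k ⊂ Ω_k` is an `M`-cube of `X` or an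
`LM`-cube meeting `X`) and *"|Y|_{𝛀′} ≤ L³|Z|_{LM}"* — typed as the hypotheses `hq`, `hvol` on `barω`; instantiating them
on a concrete `𝛀′` is the consumer's (one instance: the first closing `example`).  (iv) INDEXING: the print's `Σ_{Y⊂Y₁}
Σ_{X: X̄=Y}` is `Σ_{X: X̄⊆Y₁}` (`Y = X̄` determined by `X`); `Y₁` ranges over the whole interval `[X̄, Y₂]` (*"we drop
connectedness conditions"*); `X` over any family `𝒳 ⊆ 𝒟_k` (print: `X ⊂ Λ_k`, then *"dropping conditions X ⊂ Λ_k"* —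
here dropped only in the final count `sum_bar_subset_exp_le`).  (v) «M SUFFICIENTLY LARGE» (`κ₁ = ½log M`): three
explicit clauses replace the print's three uses (L4684, L4703∕App. D, L4710–4711); the example exhibits `κ₁ = 80`.
(vi) The analytic inputs are hypotheses exactly as printed: Part 1 takes the (tuna) summand bound on `δE_k^+(Y,Z)`
(from (unsung2) + `PolydiscCauchyBounds.lemma19_cauchy` + `tuna_term`); Part 2 bounds the collected sum `fSum` itself
(the user multiplies by `𝒪(1)λ_k^{1/4−10ε}`); (take2)∕(twinkie) — *"|(δE^+_k)′(Y)| ≤ 𝒪(1)L³λ_k^{1/4−10ε}e^{−κ′d_{LM}(Y)}"*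
by (unsung) and LEMMA 10 — is `Reblocking.norm_reblock_le` ∘ `FluctuationShiftBound.unsung` BY NAME (no new object).

**What is NOT claimed.**  The s-weakened random-walk expansions and the decoupling expansions themselves ((again),
(summer) beyond `PolydiscCauchyBounds` §8, (gong), (stingy2)∕(stingy3)), LEMMA 18's analyticity∕support argument, steps
(B)–(E) of LEMMA 3.15 beyond their summand shapes, (G)–(H) (= `ActiveBoundaryTerms`), LEMMAS 3.16∕3.17; an instance of
the middle carrier on Dimock's actual `𝒟⁰_{k+1,𝛀′}`; anything of B1–B16 (TEMPLATE.md §4.1 row «D1 §4.5» ↔ B13 §1 and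
§4.2 row «D2 §3.13» ↔ B14 §2–§3 ∕ B16 §1: the Bałaban-side columns untouched, grades unchanged).  NOT summit
progress; NOT a statement about any Bałaban paper; NOT continuum; NOT Clay.  NEW leaf; imports this lineage's
`Reblocking` (⟶ unit pv22's `TreeLengthTorusTransfer`) and `ConnectedPolymerSums` (⟶ `TreeLengthTorus`); no Summits
import; no cycle; modifies nothing; no named fact (net debt 0).  Unit `b2b-balaban-template` gen 40 round 1 (journal
CLAIM D1D2-LOCALIZATION-SUMS-KERNEL); cell records TEMPLATE.md §4.1 row «D1 §4.5», §4.2 row «D2 §3.13»; GAPS C-tmpl40-1.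

**Version.**  v1 (gen 40 round 1, literature-prover-b2b-balaban-template-g40-0, 2026-08-20) = p230235, commit c66cfab556e8: Parts 0–2 + the two closing examples.  v1.1 (gen 40 round 3, same seat, 2026-08-20): APPEND-ONLY (every v1 declaration byte-identical and in
order; this header extended): Part 3 — the two extreme INSTANCES of the middle carrier on the cell's tori (`middle_LM`,
`middle_M`, `snuffit_LM`, `snuffit_M`: (snuffit) fully concrete with `𝛀′` = all `LM`-cubes ∕ all `M`-cubes, `Δ = 2d`);
Part 4 — `summary_rates` (§3.13 Summary L5378–5412: the four printed rates dominate the common `L(κ−3κ₀−3)`).  v1.2 (gen 40 round 4, same seat,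
2026-08-20): APPEND-ONLY: Part 5 — LEMMA 3.16 (`second`)'s `R^{(0)}` term, the single-decoupling three-fold sum (sunstroke) → (x2)
L4873–4926 (*"estimated just as in part (F.) … except that now there is just a sum over Y₁"*): `fSum1`, `stovepipe_term1`,
`fSum1_eq`, `x2`, `x2_printed`.
-/

noncomputable section

open Real Finset MeasureTheory
open Literature.Probability.LatticeModels (IsRConnected)
open Literature.MathematicalPhysics.QuantumFieldTheory.Balaban1983to89.TreeLengthTorus
open Literature.MathematicalPhysics.QuantumFieldTheory.Balaban1983to89.TreeLengthTorusTransfer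
open Literature.MathematicalPhysics.QuantumFieldTheory.Balaban1983to89.B12TreeDecay (kappa₀ K₀ K₀_pos kappa₀_nonneg)
open Literature.MathematicalPhysics.QuantumFieldTheory.Dimock2011to13.Reblocking
open Literature.MathematicalPhysics.QuantumFieldTheory.Dimock2011to13.ConnectedPolymerSums (donut2_connected)

namespace Literature.MathematicalPhysics.QuantumFieldTheory.Dimock2011to13.LocalizationSumDecay

variable {d : ℕ}

/-! ## Part 0. Two finite-sum tools: the union bound over the cubes of a polymer, and the unit-box integral -/

/-- THE UNION BOUND BEHIND (sudsy)∕(slum): a sum of non-negative terms over a family of cube sets each of which meets the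
cube set `F` is at most the sum over the cubes `c ∈ F` of the sums over the members through `c`.
[cite: Dimock2013, §3 Lemma 10 proof eq. (slum) (arXiv:1108.1335v2 TeX L1462–1470); §4.5 Lemma 19 proof L2471 «the sum is bounded by 𝒪(1)|Z|_{LM} by (sudsy)»] -/
theorem sum_le_sum_mem {C : Type*} [DecidableEq C] (𝒴 : Finset (Finset C)) (F : Finset C) (f : Finset C → ℝ)
    (hf : ∀ Y ∈ 𝒴, 0 ≤ f Y) (hne : ∀ Y ∈ 𝒴, (Y ∩ F).Nonempty) :
    ∑ Y ∈ 𝒴, f Y ≤ ∑ c ∈ F, ∑ Y ∈ 𝒴.filter (fun Y => c ∈ Y), f Y := by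
  classical
  have ha : ∑ Y ∈ 𝒴, f Y ≤ ∑ Y ∈ 𝒴, ∑ _c ∈ F.filter (fun c => c ∈ Y), f Y := by
    refine sum_le_sum fun Y hY => ?_
    obtain ⟨c, hc⟩ := hne Y hY
    rw [mem_inter] at hc
    have hcF : c ∈ F.filter (fun c => c ∈ Y) := mem_filter.2 ⟨hc.2, hc.1⟩
    have hpos : (1 : ℝ) ≤ (F.filter (fun c => c ∈ Y)).card := by exact_mod_cast card_pos.2 ⟨c, hcF⟩
    rw [sum_const, nsmul_eq_mul]
    calc f Y = 1 * f Y := (one_mul _).symm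
      _ ≤ ((F.filter (fun c => c ∈ Y)).card : ℝ) * f Y := mul_le_mul_of_nonneg_right hpos (hf Y hY)
  have hb : ∑ Y ∈ 𝒴, ∑ _c ∈ F.filter (fun c => c ∈ Y), f Y
      = ∑ c ∈ F, ∑ Y ∈ 𝒴.filter (fun Y => c ∈ Y), f Y := by
    refine sum_comm' ?_
    intro Y c
    simp only [mem_filter]
    tauto
  exact ha.trans hb.le

/-- *"integrating over s_{Z−Y}"* (L2459–2460): the norm of the integral over the unit box `[0,1]^B` of a function bounded
by `c` there is at most `c` (the box has volume one).
[cite: Dimock2013, §4.5 Lemma 19 (label snort) proof L2459–2464 (arXiv:1108.1335v2 TeX)] -/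
theorem norm_integral_unitBox_le {ι : Type*} [Fintype ι] {V : Type*} [NormedAddCommGroup V] [NormedSpace ℝ V]
    {g : (ι → ℝ) → V} {c : ℝ}
    (hg : ∀ s ∈ Set.pi Set.univ (fun _ : ι => Set.Icc (0 : ℝ) 1), ‖g s‖ ≤ c) :
    ‖∫ s in Set.pi Set.univ (fun _ : ι => Set.Icc (0 : ℝ) 1), g s‖ ≤ c := by
  have hvol : volume (Set.pi Set.univ (fun _ : ι => Set.Icc (0 : ℝ) 1)) = 1 := by
    rw [volume_pi_pi]
    simp [Real.volume_Icc]
  have h := norm_setIntegral_le_of_norm_le_const (μ := volume) (f := g)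
    (by rw [hvol]; exact ENNReal.one_lt_top) hg
  have hreal : (volume : Measure (ι → ℝ)).real (Set.pi Set.univ (fun _ : ι => Set.Icc (0 : ℝ) 1)) = 1 := by
    rw [measureReal_def, hvol, ENNReal.toReal_one]
  rw [hreal, mul_one] at h
  exact h

/-- THE (tuna) SUMMAND (L2453–2464: *"|∂∕∂s_{Z−Y}[(δE_k^+)′(Y, φ, 𝒲_k(s))]| ≤ 𝒪(1)L³λ_k^{1/4−10ε} e^{−(κ₁−1)|Z−Y|_{LM}}
e^{−κ′d_{LM}(Y)}  We can assume κ₁ − 1 ≥ κ′.  Using this, integrating over s_{Z−Y} and summing over Y ⊂ Z yields"* (tuna)):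
if the integrand is bounded on the unit box by `A·e^{−(κ₁−1)m}·e^{−κ′d(Y)}` (`m = |Z−Y|_{LM}`) and `κ′ ≤ κ₁ − 1`, the
integral `δE_k^+(Y, Z)` of (summer) is bounded by `A·e^{−κ′m}·e^{−κ′d(Y)}`.
[cite: Dimock2013, §4.5 Lemma 19 (label snort) proof L2453–2464, eq. (tuna) (arXiv:1108.1335v2 TeX)] -/
theorem tuna_term {ι : Type*} [Fintype ι] {V : Type*} [NormedAddCommGroup V] [NormedSpace ℝ V]
    {g : (ι → ℝ) → V} {A κ₁ κ' dY : ℝ} {m : ℕ} (hA : 0 ≤ A) (hκ : κ' ≤ κ₁ - 1)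
    (hg : ∀ s ∈ Set.pi Set.univ (fun _ : ι => Set.Icc (0 : ℝ) 1),
      ‖g s‖ ≤ A * exp (-(κ₁ - 1) * m) * exp (-κ' * dY)) :
    ‖∫ s in Set.pi Set.univ (fun _ : ι => Set.Icc (0 : ℝ) 1), g s‖ ≤ A * exp (-κ' * m) * exp (-κ' * dY) := by
  refine (norm_integral_unitBox_le hg).trans ?_
  have hm : (0 : ℝ) ≤ m := Nat.cast_nonneg _
  have h1 : exp (-(κ₁ - 1) * m) ≤ exp (-κ' * m) := by
    rw [Real.exp_le_exp]; nlinarith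
  exact mul_le_mul_of_nonneg_right (mul_le_mul_of_nonneg_left h1 hA) (exp_pos _).le

/-! ## Part 1. Part I §4.5: LEMMA 19 (`snort`) — (tuna) → (tuna2) → (stinger) on the cell's periodic `LM`-polymer model -/

section PartI

variable {n : ℕ} [NeZero n]

/-- **LEMMA 20 (salsa) BY NAME** (L2476–2480: *"For X, Y ∈ 𝒟_k and X ⊂ Y:  Md_M(Y) ≤ M|Y−X|_M + Md_M(X)"*; used at
L2465 as *"|Z−Y|_{LM} + d_{LM}(Y) ≥ d_{LM}(Z)"*): on the cell's torus polymers this is unit pv22's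
`TreeLengthTorusTransfer.torusTreeLen_le_card_sdiff_add`, restated over `Reblocking.doms`.
[cite: Dimock2013, §4.5 Lemma 20 eq. (salsa) L2476–2492 (arXiv:1108.1335v2 TeX)] -/
theorem salsa {Y Z : Finset (TPt d n)} (hY : Y ∈ doms d n) (hZ : Z ∈ doms d n) (hYZ : Y ⊆ Z) :
    torusTreeLen Z ≤ ((Z \ Y).card : ℝ) + torusTreeLen Y :=
  torusTreeLen_le_card_sdiff_add (mem_doms.1 hY).1 hYZ (mem_doms.1 hY).2 (mem_doms.1 hZ).2

/-- **THE EXTRACTION** (L2465–2467: *"We show below that |Z−Y|_{LM} + d_{LM}(Y) ≥ d_{LM}(Z). Then we can extract a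
factor e^{−(κ′−κ_0)d_{LM}(Z)}"*): for `0 ≤ κ₀ ≤ κ′` and polymers `Y ⊆ Z`,
`e^{−κ′|Z−Y|}e^{−κ′d(Y)} ≤ e^{−(κ′−κ₀)d(Z)}e^{−κ₀d(Y)}`.
[cite: Dimock2013, §4.5 Lemma 19 (label snort) proof L2465–2470, eq. (tuna2) (arXiv:1108.1335v2 TeX)] -/
theorem extract_decay {κ₀ κ' : ℝ} (hκ₀ : 0 ≤ κ₀) (hκ : κ₀ ≤ κ') {Y Z : Finset (TPt d n)}
    (hY : Y ∈ doms d n) (hZ : Z ∈ doms d n) (hYZ : Y ⊆ Z) :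
    exp (-κ' * ((Z \ Y).card : ℝ)) * exp (-κ' * torusTreeLen Y)
      ≤ exp (-(κ' - κ₀) * torusTreeLen Z) * exp (-κ₀ * torusTreeLen Y) := by
  rw [← Real.exp_add, ← Real.exp_add, Real.exp_le_exp]
  have h := salsa hY hZ hYZ
  have hc : (0 : ℝ) ≤ (Z \ Y).card := Nat.cast_nonneg _
  have h1 : (κ' - κ₀) * torusTreeLen Z ≤ (κ' - κ₀) * (((Z \ Y).card : ℝ) + torusTreeLen Y) :=
    mul_le_mul_of_nonneg_left h (sub_nonneg.2 hκ)
  have h2 : 0 ≤ κ₀ * ((Z \ Y).card : ℝ) := mul_nonneg hκ₀ hc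
  linarith

/-- **(sudsy) SUMMED OVER THE SUB-POLYMERS OF `Z`** (L2471: *"But the sum is bounded by 𝒪(1)|Z|_{LM} by (sudsy) in the
appendix"*): for `κ ≥ κ₀(4·2^d, 2d)`, `Σ_{Y ∈ 𝒟, Y ⊆ Z} e^{−κ d(Y)} ≤ K₀(4·2^d, 2d)·|Z|` (every `Y` contains a cube of
`Z`; then `Reblocking.sum_domsAt_exp_le` cube by cube).
[cite: Dimock2013, §4.5 Lemma 19 proof L2471 and App. A eq. (sudsy) L3141 (arXiv:1108.1335v2 TeX)] -/
theorem sum_doms_subset_exp_le (Z : Finset (TPt d n)) {κ : ℝ} (hκ : kappa₀ (4 * 2 ^ d) (2 * d) ≤ κ) :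
    ∑ Y ∈ (doms d n).filter (fun Y => Y ⊆ Z), exp (-κ * torusTreeLen Y)
      ≤ K₀ (4 * 2 ^ d) (2 * d) * Z.card := by
  classical
  set 𝒴 := (doms d n).filter (fun Y => Y ⊆ Z) with h𝒴
  have hne : ∀ Y ∈ 𝒴, (Y ∩ Z).Nonempty := by
    intro Y hY
    rw [h𝒴, mem_filter, mem_doms] at hY
    obtain ⟨⟨⟨c, hc⟩, -⟩, hsub⟩ := hY
    exact ⟨c, mem_inter.2 ⟨hc, hsub hc⟩⟩
  have h1 := sum_le_sum_mem 𝒴 Z (fun Y => exp (-κ * torusTreeLen Y)) (fun Y _ => (exp_pos _).le) hne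
  have h2 : ∀ c ∈ Z, ∑ Y ∈ 𝒴.filter (fun Y => c ∈ Y), exp (-κ * torusTreeLen Y)
      ≤ K₀ (4 * 2 ^ d) (2 * d) := by
    intro c _
    refine le_trans (sum_le_sum_of_subset_of_nonneg ?_ fun Y _ _ => (exp_pos _).le) (sum_domsAt_exp_le c hκ)
    intro Y hY
    rw [mem_filter, h𝒴, mem_filter] at hY
    exact mem_domsAt.2 ⟨hY.2, (mem_doms.1 hY.1.1).2⟩
  calc ∑ Y ∈ 𝒴, exp (-κ * torusTreeLen Y)
      ≤ ∑ c ∈ Z, ∑ Y ∈ 𝒴.filter (fun Y => c ∈ Y), exp (-κ * torusTreeLen Y) := h1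
    _ ≤ ∑ _c ∈ Z, K₀ (4 * 2 ^ d) (2 * d) := sum_le_sum h2
    _ = K₀ (4 * 2 ^ d) (2 * d) * Z.card := by rw [sum_const, nsmul_eq_mul, mul_comm]

/-- **(newloc)** (L2396–2398: *"(δE^+_k)^{loc}(Z) = Σ_{Y⊂Z} δE_k^+(Y, Z)"*, *"Here Y is connected but Z may not be"*): the
localized piece of a two-polymer function `δE(Y, Z)`, summed over the polymers `Y ∈ 𝒟` inside the cube set `Z`.
[cite: Dimock2013, §4.5 eq. (newloc) L2396–2400 (arXiv:1108.1335v2 TeX)] -/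
def loc {V : Type*} [AddCommMonoid V] (dE : Finset (TPt d n) → Finset (TPt d n) → V) (Z : Finset (TPt d n)) : V :=
  ∑ Y ∈ (doms d n).filter (fun Y => Y ⊆ Z), dE Y Z

/-- THE RE-SUMMATION BEFORE (newloc) (L2391–2395: *"δE_k^+ = Σ_Y (δE_k^+)′(Y) = Σ_Y Σ_{Z⊃Y} δE_k^+(Y, Z) = Σ_Z
(δE^+_k)^{loc}(Z)"*): exchanging the sum over polymers `Y` and the sum over all cube sets `Z ⊇ Y`.
[cite: Dimock2013, §4.5 L2391–2398 (arXiv:1108.1335v2 TeX)] -/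
theorem sum_sum_supsets_eq_sum_loc {V : Type*} [AddCommMonoid V] (dE : Finset (TPt d n) → Finset (TPt d n) → V) :
    ∑ Y ∈ doms d n, ∑ Z ∈ (univ : Finset (Finset (TPt d n))).filter (fun Z => Y ⊆ Z), dE Y Z
      = ∑ Z ∈ (univ : Finset (Finset (TPt d n))), loc dE Z := by
  unfold loc
  refine sum_comm' ?_
  intro Y Z
  simp only [mem_filter, mem_univ, true_and]
  tauto

/-- LEMMA 18's RESTRICTION TO CONNECTED `Z` (L2403–2404: *"In the expansion δE_k^+ = Σ_Z (δE^+_k)^{loc}(Z) we can restrict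
to connected Z, i.e. Z ∈ 𝒟⁰_{k+1}"*) as bookkeeping: if `δE(Y, Z)` vanishes unless `Z` is a polymer (the analytic content
of LEMMA 18, a hypothesis here), the sum over all `Z` is the sum over `Z ∈ 𝒟`.
[cite: Dimock2013, §4.5 Lemma 18 L2403–2427 (arXiv:1108.1335v2 TeX)] -/
theorem sum_loc_eq_sum_doms {V : Type*} [AddCommMonoid V] (dE : Finset (TPt d n) → Finset (TPt d n) → V)
    (h0 : ∀ Y Z, Z ∉ doms d n → dE Y Z = 0) :
    ∑ Z ∈ (univ : Finset (Finset (TPt d n))), loc dE Z = ∑ Z ∈ doms d n, loc dE Z := by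
  symm
  refine sum_subset (subset_univ _) ?_
  intro Z _ hZ
  unfold loc
  exact sum_eq_zero fun Y _ => h0 Y Z hZ

/-- **LEMMA 19 (`snort`) ASSEMBLED: (tuna) → (tuna2) → (stinger)** (L2461–2473: *"|(δE^+_k)^{loc}(Z, φ, W)| ≤
𝒪(1)L³λ_k^{1/4−10ε} Σ_{Y⊂Z} e^{−κ′|Z−Y|_{LM} − κ′d_{LM}(Y)}  We show below that |Z−Y|_{LM} + d_{LM}(Y) ≥ d_{LM}(Z). Then
we can extract a factor e^{−(κ′−κ_0)d_{LM}(Z)} and obtain |(δE^+_k)^{loc}(Z, φ, W)| ≤ 𝒪(1)L³λ_k^{1/4−10ε}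
e^{−(κ′−κ_0)d_{LM}(Z)} Σ_{Y⊂Z} e^{−κ_0 d_{LM}(Y)}  But the sum is bounded by 𝒪(1)|Z|_{LM} by (sudsy) in the appendix.
Furthermore by (ninety) |Z|_{LM} ≤ 𝒪(1)(d_{LM}(Z) + 1) ≤ 𝒪(1)e^{d_{LM}(Z)}"*): on the cell's periodic `LM`-polymer
model, every dimension `d`, if `‖δE(Y, Z)‖ ≤ A·e^{−κ′|Z−Y|}·e^{−κ′d(Y)}` for the polymers `Y ⊆ Z` (the (tuna) summand;
`A = 𝒪(1)L³λ_k^{1/4−10ε}`) and `κ′ ≥ κ₀ = κ₀(4·2^d, 2d)`, then for every polymer `Z`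
`‖(δE)^{loc}(Z)‖ ≤ 2^d·K₀·A·e^{−(κ′−κ₀−4)d(Z)}` — the volume bound of the model being `|Z| ≤ 2^d(4d(Z)+1) ≤ 2^d e^{4d(Z)}`
(unit pv22's `card_le_torusTreeLen`), whence the rate offset `4` for the printed `1` and the prefactor `2^d K₀` for
`𝒪(1)`, DECLARED divergence of constants as in `Reblocking.norm_reblock_le`.
[cite: Dimock2013, §4.5 Lemma 19 (label snort) eq. (stinger) L2432–2437 with proof (tuna)–(tuna2) L2459–2473 (arXiv:1108.1335v2 TeX)] -/
theorem stinger {V : Type*} [SeminormedAddCommGroup V] (dE : Finset (TPt d n) → Finset (TPt d n) → V)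
    {A κ' : ℝ} (hA : 0 ≤ A) (hκ' : kappa₀ (4 * 2 ^ d) (2 * d) ≤ κ') {Z : Finset (TPt d n)} (hZ : Z ∈ doms d n)
    (hdE : ∀ Y ∈ doms d n, Y ⊆ Z →
      ‖dE Y Z‖ ≤ A * exp (-κ' * ((Z \ Y).card : ℝ)) * exp (-κ' * torusTreeLen Y)) :
    ‖loc dE Z‖ ≤ 2 ^ d * K₀ (4 * 2 ^ d) (2 * d) * A *
        exp (-(κ' - kappa₀ (4 * 2 ^ d) (2 * d) - 4) * torusTreeLen Z) := by
  classical
  set κ₀ := kappa₀ (4 * 2 ^ d) (2 * d) with hκ₀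
  set K := K₀ (4 * 2 ^ d) (2 * d) with hK
  have hKpos : 0 < K := K₀_pos _ _
  have hκ₀0 : 0 ≤ κ₀ := kappa₀_nonneg (by positivity) _
  set S := (doms d n).filter (fun Y => Y ⊆ Z) with hS
  set dZ := torusTreeLen Z with hdZ
  have hdZ0 : 0 ≤ dZ := torusTreeLen_nonneg Z
  -- (tuna)
  have h1 : ‖loc dE Z‖ ≤ ∑ Y ∈ S, ‖dE Y Z‖ := norm_sum_le _ _
  -- the extraction, termwise
  have h2 : ∀ Y ∈ S, ‖dE Y Z‖ ≤ A * exp (-(κ' - κ₀) * dZ) * exp (-κ₀ * torusTreeLen Y) := by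
    intro Y hY
    rw [hS, mem_filter] at hY
    have hx := extract_decay hκ₀0 hκ' hY.1 hZ hY.2
    calc ‖dE Y Z‖ ≤ A * exp (-κ' * ((Z \ Y).card : ℝ)) * exp (-κ' * torusTreeLen Y) := hdE Y hY.1 hY.2
      _ = A * (exp (-κ' * ((Z \ Y).card : ℝ)) * exp (-κ' * torusTreeLen Y)) := by ring
      _ ≤ A * (exp (-(κ' - κ₀) * dZ) * exp (-κ₀ * torusTreeLen Y)) := mul_le_mul_of_nonneg_left hx hA
      _ = A * exp (-(κ' - κ₀) * dZ) * exp (-κ₀ * torusTreeLen Y) := by ring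
  -- (tuna2)'s sum by (sudsy)
  have h3 : ∑ Y ∈ S, exp (-κ₀ * torusTreeLen Y) ≤ K * Z.card :=
    sum_doms_subset_exp_le Z (le_of_eq hκ₀.symm)
  -- (ninety)
  have h4 : (Z.card : ℝ) ≤ 2 ^ d * exp (4 * dZ) := by
    have hZd := mem_doms.1 hZ
    have hv := card_le_torusTreeLen hZd.1 hZd.2
    have he : 4 * dZ + 1 ≤ exp (4 * dZ) := Real.add_one_le_exp _
    calc (Z.card : ℝ) ≤ 2 ^ d * (4 * dZ + 1) := hv
      _ ≤ 2 ^ d * exp (4 * dZ) := mul_le_mul_of_nonneg_left he (by positivity)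
  have hB : 0 ≤ A * exp (-(κ' - κ₀) * dZ) := mul_nonneg hA (exp_pos _).le
  calc ‖loc dE Z‖ ≤ ∑ Y ∈ S, ‖dE Y Z‖ := h1
    _ ≤ ∑ Y ∈ S, A * exp (-(κ' - κ₀) * dZ) * exp (-κ₀ * torusTreeLen Y) := sum_le_sum h2
    _ = A * exp (-(κ' - κ₀) * dZ) * ∑ Y ∈ S, exp (-κ₀ * torusTreeLen Y) := by rw [mul_sum]
    _ ≤ A * exp (-(κ' - κ₀) * dZ) * (K * Z.card) := mul_le_mul_of_nonneg_left h3 hB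
    _ ≤ A * exp (-(κ' - κ₀) * dZ) * (K * (2 ^ d * exp (4 * dZ))) :=
        mul_le_mul_of_nonneg_left (mul_le_mul_of_nonneg_left h4 hKpos.le) hB
    _ = 2 ^ d * K * A * (exp (-(κ' - κ₀) * dZ) * exp (4 * dZ)) := by ring
    _ = 2 ^ d * K * A * exp (-(κ' - κ₀ - 4) * dZ) := by rw [← Real.exp_add]; ring_nf

/-- **(stinger) IN THE PRINTED SHAPE** (L2473: *"Since κ′ − κ_0 − 1 ≥ L(κ − 2κ_0 − 2) this gives the result"*, with
`κ′ = L(κ−κ_0−1)` the reblocking rate of (take2) ∕ LEMMA 10): for every `L ≥ 4` (so that the model's offset `4`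
is covered: `L(κ−κ₀−1) − κ₀ − 4 ≥ L(κ−2κ₀−2)`), `‖(δE)^{loc}(Z)‖ ≤ 2^d·K₀·A·e^{−L(κ−2κ₀−2)d(Z)}`.
[cite: Dimock2013, §4.5 Lemma 19 (label snort) eq. (stinger) L2432–2437, proof L2473 (arXiv:1108.1335v2 TeX)] -/
theorem stinger_printed {V : Type*} [SeminormedAddCommGroup V] (dE : Finset (TPt d n) → Finset (TPt d n) → V)
    {A κ : ℝ} {L : ℕ} (hA : 0 ≤ A) (hL4 : 4 ≤ L)
    (hκ' : kappa₀ (4 * 2 ^ d) (2 * d) ≤ L * (κ - kappa₀ (4 * 2 ^ d) (2 * d) - 1))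
    {Z : Finset (TPt d n)} (hZ : Z ∈ doms d n)
    (hdE : ∀ Y ∈ doms d n, Y ⊆ Z →
      ‖dE Y Z‖ ≤ A * exp (-(L * (κ - kappa₀ (4 * 2 ^ d) (2 * d) - 1)) * ((Z \ Y).card : ℝ)) *
        exp (-(L * (κ - kappa₀ (4 * 2 ^ d) (2 * d) - 1)) * torusTreeLen Y)) :
    ‖loc dE Z‖ ≤ 2 ^ d * K₀ (4 * 2 ^ d) (2 * d) * A *
        exp (-(L * (κ - 2 * kappa₀ (4 * 2 ^ d) (2 * d) - 2)) * torusTreeLen Z) := by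
  have h := stinger dE hA hκ' hZ hdE
  refine h.trans (mul_le_mul_of_nonneg_left ?_ ?_)
  · rw [Real.exp_le_exp]
    have hL4r : (4 : ℝ) ≤ L := by exact_mod_cast hL4
    have hdZ0 : 0 ≤ torusTreeLen Z := torusTreeLen_nonneg Z
    have hκ₀0 : 0 ≤ kappa₀ (4 * 2 ^ d) (2 * d) := kappa₀_nonneg (by positivity) _
    have hk : (L : ℝ) * (κ - 2 * kappa₀ (4 * 2 ^ d) (2 * d) - 2)
        ≤ L * (κ - kappa₀ (4 * 2 ^ d) (2 * d) - 1) - kappa₀ (4 * 2 ^ d) (2 * d) - 4 := by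
      nlinarith
    nlinarith
  · have := K₀_pos (4 * 2 ^ d) (2 * d)
    positivity

end PartI

/-! ## Part 2. Part II §3.13 LEMMA 3.15 step (F): (stovepipe) → (snuffit) — the four-fold sum over
`(Y₂, Y₁, Y = X̄, X)` with the multiscale middle carrier `𝒟⁰_{k+1,𝛀′}` abstract -/

section PartII

variable {L N' : ℕ} [NeZero L] [NeZero N']
variable {C : Type*} [Fintype C] [DecidableEq C]

/-! ### The three levels: `M`-polymers `X` of the fine torus, elementary `𝛀′`-cubes `C` with their `LM`-blocking
`q : C → LM-cubes`, `LM`-polymers `Z` of the coarse torus -/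

omit [Fintype C] in
/-- *"in passing from Y₂ − Ȳ to Z − Ȳ we replace each elementary 𝒟⁰_{k+1,𝛀′} cube in Y₂ − Ȳ by the LM cube containing
it, and this cannot increase the number of elementary cubes"* (L4681–4683): for any blocking map `q` and `Y ⊆ Y₂`,
`|q(Y₂) − q(Y)| ≤ |Y₂ − Y|`. [cite: Dimock2013BalabanII, §3.13 Lemma 3.15 proof (F) L4678–4683 (arXiv:1212.5562v2 TeX)] -/
theorem card_image_sdiff_image_le {D : Type*} [DecidableEq D] (q : C → D) (Y Y₂ : Finset C) :
    ((Y₂.image q) \ (Y.image q)).card ≤ (Y₂ \ Y).card := by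
  classical
  have hsub : (Y₂.image q) \ (Y.image q) ⊆ (Y₂ \ Y).image q := by
    intro b hb
    rw [mem_sdiff, mem_image] at hb
    obtain ⟨⟨c, hc, rfl⟩, hnot⟩ := hb
    exact mem_image.2 ⟨c, mem_sdiff.2 ⟨hc, fun hcY => hnot (mem_image_of_mem q hcY)⟩, rfl⟩
  exact (card_le_card hsub).trans card_image_le

omit [Fintype C] in
/-- *"|Y₂ − Y₁|_{𝛀′} + |Y₁ − Y|_{𝛀′} = |Y₂ − Y|_{𝛀′}"* (L4678) for `Y ⊆ Y₁ ⊆ Y₂`.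
[cite: Dimock2013BalabanII, §3.13 Lemma 3.15 proof (F) L4678 (arXiv:1212.5562v2 TeX)] -/
theorem card_sdiff_add_card_sdiff {Y Y₁ Y₂ : Finset C} (h1 : Y ⊆ Y₁) (h2 : Y₁ ⊆ Y₂) :
    (Y₂ \ Y₁).card + (Y₁ \ Y).card = (Y₂ \ Y).card := by
  rw [card_sdiff_of_subset h2, card_sdiff_of_subset h1, card_sdiff_of_subset (h1.trans h2)]
  have := card_le_card h1
  have := card_le_card h2
  omega

omit [Fintype C] in
/-- *"Σ_{Y ⊂ Y₁ ⊂ Y₂} 1 ≤ number of subsets of cubes in Y₂ − Y₁* [sic: `Y₂ − Y`] *≤ 2^{|Y₂−Y|_{𝛀′}}"* (L4700–4702): the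
middle sets form the interval `[Y, Y₂]` of the subset lattice, of cardinality exactly `2^{|Y₂ − Y|}` (Mathlib's
`Finset.card_Icc_finset`). [cite: Dimock2013BalabanII, §3.13 Lemma 3.15 proof (F) L4700–4703 (arXiv:1212.5562v2 TeX)] -/
theorem card_Icc_eq_two_pow {Y Y₂ : Finset C} (h : Y ⊆ Y₂) : (Finset.Icc Y Y₂).card = 2 ^ (Y₂ \ Y).card := by
  rw [card_Icc_finset h, card_sdiff_of_subset h]

/-- *"This is absorbed by replacing ½κ₁ by ¼κ₁"* (L4703): `2^m e^{−½κ₁ m} ≤ e^{−¼κ₁ m}` as soon as `log 2 ≤ ¼κ₁`.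
[cite: Dimock2013BalabanII, §3.13 Lemma 3.15 proof (F) L4700–4703 (arXiv:1212.5562v2 TeX)] -/
theorem two_pow_mul_exp_le {κ₁ : ℝ} (hlog : Real.log 2 ≤ κ₁ / 4) (m : ℕ) :
    (2 : ℝ) ^ m * exp (-(κ₁ / 2) * m) ≤ exp (-(κ₁ / 4) * m) := by
  have e1 : exp (-(κ₁ / 2) * m) = exp (-(κ₁ / 2)) ^ m := by
    rw [← Real.exp_nat_mul]; ring_nf
  have e2 : exp (-(κ₁ / 4) * m) = exp (-(κ₁ / 4)) ^ m := by
    rw [← Real.exp_nat_mul]; ring_nf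
  rw [e1, e2, ← mul_pow]
  refine pow_le_pow_left₀ (by positivity) ?_ m
  have h2 : (2 : ℝ) ≤ exp (κ₁ / 4) := by
    calc (2 : ℝ) = exp (Real.log 2) := (Real.exp_log two_pos).symm
      _ ≤ exp (κ₁ / 4) := Real.exp_le_exp.2 hlog
  have h3 : exp (κ₁ / 4) * exp (-(κ₁ / 2)) = exp (-(κ₁ / 4)) := by
    rw [← Real.exp_add]; ring_nf
  calc 2 * exp (-(κ₁ / 2)) ≤ exp (κ₁ / 4) * exp (-(κ₁ / 2)) :=
      mul_le_mul_of_nonneg_right h2 (exp_pos _).le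
    _ = exp (-(κ₁ / 4)) := h3

omit [Fintype C] in
/-- **(stovepipe), TERMWISE** (L4676–4697: *"Now Md_M(X) ≥ LMd_{LM}(Ȳ) since a tree joining the M cubes in X will also
join the LM cubes in Ȳ ∈ 𝒟⁰_{k+1}. Thus we can extract a factor exp(−L(κ−κ_0)d_{LM}(Ȳ)) leaving exp(−κ_0 d_M(X)).  Now
|Y₂−Y₁|_{𝛀′} + |Y₁−Y|_{𝛀′} = |Y₂−Y|_{𝛀′} ≥ |Y₂−Ȳ|_{𝛀′} ≥ |Z−Ȳ|_{LM} … Then we can extract a factor exp(−(κ₁∕2−1)|Z−Ȳ|_{LM})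
which for M sufficiently large is less than exp(−L(κ−κ_0)|Z−Ȳ|_{LM}).  Now use the inequality from part I: |Z−Ȳ|_{LM}
+ d_{LM}(Ȳ) ≥ d_{LM}(Z) to dominate the extracted factors by exp(−L(κ−κ_0)d_{LM}(Z))"*): for an `M`-polymer `X` of
the fine torus with `𝛀′`-blocking `Y` (`q(Y) = X̄`, the `LM`-blocking `Reblocking.bar`), middle sets `Y ⊆ Y₁ ⊆ Y₂` with
`q(Y₂) = Z` an `LM`-polymer, `κ ≥ κ₀` and *"M sufficiently large"* EXPLICIT as `L(κ−κ₀) ≤ ½κ₁ − 1`: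
`e^{−(κ₁−1)|Y₂−Y₁|}e^{−(κ₁−1)|Y₁−Y|}e^{−κd(X)} ≤ e^{−L(κ−κ₀)d(Z)}·e^{−½κ₁|Y₂−Y|}·e^{−κ₀d(X)}` — by LEMMA 10's coarsening
(`mul_torusTreeLen_image_le`), LEMMA 20 (`salsa`) and `card_image_sdiff_image_le`.
[cite: Dimock2013BalabanII, §3.13 Lemma 3.15 proof (F) L4665–4697, eq. (stovepipe) (arXiv:1212.5562v2 TeX)] -/
theorem stovepipe_term {κ κ₁ : ℝ} (hκ : kappa₀ (4 * 2 ^ d) (2 * d) ≤ κ)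
    (hM : (L : ℝ) * (κ - kappa₀ (4 * 2 ^ d) (2 * d)) ≤ κ₁ / 2 - 1)
    (q : C → TPt d N') {X : Finset (TPt d (L * N'))} (hX : X ∈ doms d (L * N'))
    {Y Y₁ Y₂ : Finset C} (hYq : Y.image q = bar L N' X) (h1 : Y ⊆ Y₁) (h2 : Y₁ ⊆ Y₂)
    {Z : Finset (TPt d N')} (hZ : Z ∈ doms d N') (hY₂q : Y₂.image q = Z) :
    exp (-(κ₁ - 1) * ((Y₂ \ Y₁).card : ℝ)) * exp (-(κ₁ - 1) * ((Y₁ \ Y).card : ℝ)) *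
        exp (-κ * torusTreeLen X)
      ≤ exp (-(L * (κ - kappa₀ (4 * 2 ^ d) (2 * d))) * torusTreeLen Z) *
        (exp (-(κ₁ / 2) * ((Y₂ \ Y).card : ℝ)) * exp (-kappa₀ (4 * 2 ^ d) (2 * d) * torusTreeLen X)) := by
  set κ₀ := kappa₀ (4 * 2 ^ d) (2 * d) with hκ₀
  have hL : (1 : ℝ) ≤ L := by exact_mod_cast Nat.one_le_iff_ne_zero.2 (NeZero.ne L)
  -- nested differences
  have hm : ((Y₂ \ Y₁).card : ℝ) + ((Y₁ \ Y).card : ℝ) = ((Y₂ \ Y).card : ℝ) := by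
    exact_mod_cast card_sdiff_add_card_sdiff h1 h2
  -- `Ȳ = bar X ⊆ Z`, an `LM`-polymer
  have hXd := mem_doms.1 hX
  have hbar : bar L N' X ∈ doms d N' := bar_mem_doms hX
  have hbarZ : bar L N' X ⊆ Z := by
    rw [← hYq, ← hY₂q]; exact image_subset_image (h1.trans h2)
  -- (i) `L·d(Ȳ) ≤ d(X)`
  have hi : (L : ℝ) * torusTreeLen (bar L N' X) ≤ torusTreeLen X := mul_torusTreeLen_image_le hXd.1 hXd.2
  -- (ii) LEMMA 20 on the coarse torus
  have hii : torusTreeLen Z ≤ ((Z \ bar L N' X).card : ℝ) + torusTreeLen (bar L N' X) := salsa hbar hZ hbarZ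
  -- (iii) `|Z − Ȳ| ≤ |Y₂ − Y|`
  have hiii : ((Z \ bar L N' X).card : ℝ) ≤ ((Y₂ \ Y).card : ℝ) := by
    rw [← hYq, ← hY₂q]; exact_mod_cast card_image_sdiff_image_le q Y Y₂
  have eL : exp (-(κ₁ - 1) * ((Y₂ \ Y₁).card : ℝ)) * exp (-(κ₁ - 1) * ((Y₁ \ Y).card : ℝ)) *
        exp (-κ * torusTreeLen X)
      = exp (-(κ₁ - 1) * ((Y₂ \ Y₁).card : ℝ) + -(κ₁ - 1) * ((Y₁ \ Y).card : ℝ) + -κ * torusTreeLen X) := by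
    rw [Real.exp_add, Real.exp_add]
  have eR : exp (-(L * (κ - κ₀)) * torusTreeLen Z) *
        (exp (-(κ₁ / 2) * ((Y₂ \ Y).card : ℝ)) * exp (-κ₀ * torusTreeLen X))
      = exp (-(L * (κ - κ₀)) * torusTreeLen Z + (-(κ₁ / 2) * ((Y₂ \ Y).card : ℝ) + -κ₀ * torusTreeLen X)) := by
    rw [Real.exp_add, Real.exp_add]
  rw [eL, eR, Real.exp_le_exp]
  have hk : 0 ≤ κ - κ₀ := sub_nonneg.2 hκ
  have hLk : 0 ≤ (L : ℝ) * (κ - κ₀) := mul_nonneg (by linarith) hk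
  have hA' : (L : ℝ) * (κ - κ₀) * torusTreeLen Z
      ≤ (L : ℝ) * (κ - κ₀) * (((Z \ bar L N' X).card : ℝ) + torusTreeLen (bar L N' X)) :=
    mul_le_mul_of_nonneg_left hii hLk
  have hB1 : (L : ℝ) * (κ - κ₀) * ((Z \ bar L N' X).card : ℝ) ≤ (κ₁ / 2 - 1) * ((Z \ bar L N' X).card : ℝ) :=
    mul_le_mul_of_nonneg_right hM (Nat.cast_nonneg _)
  have hB2 : (κ₁ / 2 - 1) * ((Z \ bar L N' X).card : ℝ) ≤ (κ₁ / 2 - 1) * ((Y₂ \ Y).card : ℝ) :=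
    mul_le_mul_of_nonneg_left hiii (by linarith)
  have hC' : (κ - κ₀) * ((L : ℝ) * torusTreeLen (bar L N' X)) ≤ (κ - κ₀) * torusTreeLen X :=
    mul_le_mul_of_nonneg_left hi hk
  rw [← hm]
  rw [← hm] at hB2
  nlinarith [hA', hB1, hB2, hC']

/-! ### The collected sum of (F) and its bound (snuffit) -/

/-- the connected multiscale polymers `Y₂ ∈ 𝒟⁰_{k+1,𝛀′}` with `LM`-blocking `Ȳ₂ = Z` (the index set *"Σ_{Y₂: Ȳ₂ = Z}"*
of (F), L4671; connectivity through the elementary-cube adjacency `R`).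
[cite: Dimock2013BalabanII, §3.13 Lemma 3.15 proof (E)–(F) L4652–4675 (arXiv:1212.5562v2 TeX)] -/
def P2 (R : C → C → Prop) (q : C → TPt d N') (Z : Finset (TPt d N')) : Finset (Finset C) := by
  classical exact univ.filter (fun Y₂ => IsRConnected R Y₂ ∧ Y₂.image q = Z)

omit [NeZero N'] [DecidableEq C] in
/-- membership in `P2`. [cite: Dimock2013BalabanII, §3.13 Lemma 3.15 proof (E)–(F) L4652–4675 (arXiv:1212.5562v2 TeX)] -/
theorem mem_P2 {R : C → C → Prop} {q : C → TPt d N'} {Z : Finset (TPt d N')} {Y₂ : Finset C} :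
    Y₂ ∈ P2 R q Z ↔ IsRConnected R Y₂ ∧ Y₂.image q = Z := by
  classical
  unfold P2
  simp

/-- **THE COLLECTED SUM OF (F)** (L4667–4675: *"|(δE^+_k)^{(iv)}(Z)| ≤ 𝒪(1)λ_k^{1/4−10ε} Σ_{Y₂: Ȳ₂=Z} Σ_{Y₁⊂Y₂} Σ_{Y⊂Y₁}
Σ_{X: X̄=Y} exp(−(κ₁−1)|Y₂−Y₁|_{𝛀′} − (κ₁−1)|Y₁−Y|_{𝛀′} − κd_M(X))"*), indexed by the triples `(Y₂, X, Y₁)` with `Y = X̄`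
the `𝛀′`-blocking `barω X` of the `M`-polymer `X` (so `Σ_{Y⊂Y₁} Σ_{X: X̄=Y} = Σ_{X: X̄ ⊂ Y₁}`), `X` ranging over a
family `𝒳` of `M`-polymers (print: `X ⊂ Λ_k`, *"dropping conditions X ⊂ Λ_k"*), `Y₁` over the interval `[X̄, Y₂]`
(*"we drop connectedness conditions"* L4700).
[cite: Dimock2013BalabanII, §3.13 Lemma 3.15 proof (F) L4665–4675 (arXiv:1212.5562v2 TeX)] -/
def fSum (R : C → C → Prop) (q : C → TPt d N') (barω : Finset (TPt d (L * N')) → Finset C)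
    (𝒳 : Finset (Finset (TPt d (L * N')))) (κ κ₁ : ℝ) (Z : Finset (TPt d N')) : ℝ :=
  ∑ Y₂ ∈ P2 R q Z, ∑ X ∈ 𝒳.filter (fun X => barω X ⊆ Y₂), ∑ Y₁ ∈ Finset.Icc (barω X) Y₂,
    exp (-(κ₁ - 1) * ((Y₂ \ Y₁).card : ℝ)) * exp (-(κ₁ - 1) * ((Y₁ \ barω X).card : ℝ)) *
      exp (-κ * torusTreeLen X)

omit [Fintype C] in
/-- THE `Y₁`-SUM (L4700–4703): for fixed `X` (with `𝛀′`-blocking `Y`) and `Y₂ ⊇ Y` with `Ȳ₂ = Z`, summing the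
(stovepipe) bound over the `2^{|Y₂−Y|}` middle sets and absorbing the count into the rate:
`Σ_{Y₁ ∈ [Y, Y₂]} (…) ≤ e^{−L(κ−κ₀)d(Z)}·e^{−¼κ₁|Y₂−Y|}·e^{−κ₀d(X)}`.
[cite: Dimock2013BalabanII, §3.13 Lemma 3.15 proof (F) L4693–4703 (arXiv:1212.5562v2 TeX)] -/
theorem sum_Icc_le {κ κ₁ : ℝ} (hκ : kappa₀ (4 * 2 ^ d) (2 * d) ≤ κ)
    (hM : (L : ℝ) * (κ - kappa₀ (4 * 2 ^ d) (2 * d)) ≤ κ₁ / 2 - 1) (hlog : Real.log 2 ≤ κ₁ / 4)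
    (q : C → TPt d N') {X : Finset (TPt d (L * N'))} (hX : X ∈ doms d (L * N'))
    {Y Y₂ : Finset C} (hYq : Y.image q = bar L N' X) (hY : Y ⊆ Y₂)
    {Z : Finset (TPt d N')} (hZ : Z ∈ doms d N') (hY₂q : Y₂.image q = Z) :
    ∑ Y₁ ∈ Finset.Icc Y Y₂, exp (-(κ₁ - 1) * ((Y₂ \ Y₁).card : ℝ)) * exp (-(κ₁ - 1) * ((Y₁ \ Y).card : ℝ)) *
        exp (-κ * torusTreeLen X)
      ≤ exp (-(L * (κ - kappa₀ (4 * 2 ^ d) (2 * d))) * torusTreeLen Z) *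
        (exp (-(κ₁ / 4) * ((Y₂ \ Y).card : ℝ)) * exp (-kappa₀ (4 * 2 ^ d) (2 * d) * torusTreeLen X)) := by
  set κ₀ := kappa₀ (4 * 2 ^ d) (2 * d) with hκ₀
  set T₀ := exp (-(L * (κ - κ₀)) * torusTreeLen Z) *
    (exp (-(κ₁ / 2) * ((Y₂ \ Y).card : ℝ)) * exp (-κ₀ * torusTreeLen X)) with hT₀
  have h1 : ∀ Y₁ ∈ Finset.Icc Y Y₂,
      exp (-(κ₁ - 1) * ((Y₂ \ Y₁).card : ℝ)) * exp (-(κ₁ - 1) * ((Y₁ \ Y).card : ℝ)) *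
        exp (-κ * torusTreeLen X) ≤ T₀ := by
    intro Y₁ hY₁
    rw [Finset.mem_Icc] at hY₁
    exact stovepipe_term hκ hM q hX hYq hY₁.1 hY₁.2 hZ hY₂q
  have h2 := sum_le_sum h1
  rw [sum_const, nsmul_eq_mul, card_Icc_eq_two_pow hY] at h2
  push_cast at h2
  refine h2.trans ?_
  have h3 := two_pow_mul_exp_le hlog (Y₂ \ Y).card
  have hpos : 0 ≤ exp (-(L * (κ - κ₀)) * torusTreeLen Z) * exp (-κ₀ * torusTreeLen X) :=
    mul_nonneg (exp_pos _).le (exp_pos _).le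
  calc (2 : ℝ) ^ (Y₂ \ Y).card * T₀
      = exp (-(L * (κ - κ₀)) * torusTreeLen Z) * exp (-κ₀ * torusTreeLen X) *
          ((2 : ℝ) ^ (Y₂ \ Y).card * exp (-(κ₁ / 2) * ((Y₂ \ Y).card : ℝ))) := by rw [hT₀]; ring
    _ ≤ exp (-(L * (κ - κ₀)) * torusTreeLen Z) * exp (-κ₀ * torusTreeLen X) *
          exp (-(κ₁ / 4) * ((Y₂ \ Y).card : ℝ)) := mul_le_mul_of_nonneg_left h3 hpos
    _ = _ := by ring

omit [NeZero L] [NeZero N'] in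
/-- THE EXCHANGE *"Σ_{Y₂⊂Z} Σ_{Y⊂Y₂} ≤ Σ_{Y⊂Z} Σ_{Y₂⊃Y}"* (L4704): the collected sum re-indexed by the `M`-polymers `X`
with `X̄ ⊆ Z` outside and the connected `Y₂ ⊇ X̄^{𝛀′}` with `Ȳ₂ = Z` inside (an identity; `q(X̄^{𝛀′}) = X̄`).
[cite: Dimock2013BalabanII, §3.13 Lemma 3.15 proof (F) L4704 (arXiv:1212.5562v2 TeX)] -/
theorem fSum_eq (R : C → C → Prop) (q : C → TPt d N') (barω : Finset (TPt d (L * N')) → Finset C)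
    (𝒳 : Finset (Finset (TPt d (L * N')))) (hq : ∀ X ∈ 𝒳, (barω X).image q = bar L N' X) (κ κ₁ : ℝ)
    (Z : Finset (TPt d N')) :
    fSum R q barω 𝒳 κ κ₁ Z
      = ∑ X ∈ 𝒳.filter (fun X => bar L N' X ⊆ Z), ∑ Y₂ ∈ (P2 R q Z).filter (fun Y₂ => barω X ⊆ Y₂),
          ∑ Y₁ ∈ Finset.Icc (barω X) Y₂,
            exp (-(κ₁ - 1) * ((Y₂ \ Y₁).card : ℝ)) * exp (-(κ₁ - 1) * ((Y₁ \ barω X).card : ℝ)) *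
              exp (-κ * torusTreeLen X) := by
  unfold fSum
  refine sum_comm' ?_
  intro Y₂ X
  simp only [mem_filter]
  constructor
  · rintro ⟨hY₂, hX, hsub⟩
    refine ⟨⟨hY₂, hsub⟩, hX, ?_⟩
    rw [← hq X hX, ← (mem_P2.1 hY₂).2]
    exact image_subset_image hsub
  · rintro ⟨⟨hY₂, hsub⟩, hX, -⟩
    exact ⟨hY₂, hX, hsub⟩

omit [NeZero L] [NeZero N'] in
/-- THE `Y₂`-SUM BY APP. D LEMMA D.2 (L4704–4708: *"the sum over Y₂ is estimated by lemma D.2 in the appendix (here Y, Y₂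
are connected and we use LM cubes)  Σ_{Y₂⊃Y} e^{−¼κ₁|Y₂−Y|_{𝛀′}} ≤ exp(Ce^{−⅛κ₁}|Y|_{𝛀′})"*): `ConnectedPolymerSums.donut2_connected`
BY NAME at rate `¼κ₁`, with `C = Δ + 1` for an elementary-cube adjacency of degree `≤ Δ` (print: `Δ = 2dL^{d−1}`) under
its clause `log 2 + 2log(Δ+1) ≤ ⅛κ₁`. [cite: Dimock2013BalabanII, §3.13 Lemma 3.15 proof (F) L4704–4708 and App. D Lemma D.2 (arXiv:1212.5562v2 TeX)] -/
theorem sum_P2_le {R : C → C → Prop} (hR : ∀ x y, R x y → R y x) {nbr : C → Finset C} {Δ : ℕ}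
    (hΔ : ∀ x, (nbr x).card ≤ Δ) (hnbr : ∀ x y, R x y → y ∈ nbr x) {κ₁ : ℝ}
    (hκ₁ : Real.log 2 + 2 * Real.log ((Δ : ℝ) + 1) ≤ κ₁ / 8) (q : C → TPt d N') {Y : Finset C}
    (hYne : Y.Nonempty) (Z : Finset (TPt d N')) :
    ∑ Y₂ ∈ (P2 R q Z).filter (fun Y₂ => Y ⊆ Y₂), exp (-(κ₁ / 4) * ((Y₂ \ Y).card : ℝ))
      ≤ exp (exp (-(κ₁ / 8)) * (((Δ : ℝ) + 1) * Y.card)) := by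
  have hκ' : Real.log 2 + 2 * Real.log ((Δ : ℝ) + 1) ≤ κ₁ / 4 / 2 := by
    rw [show κ₁ / 4 / 2 = κ₁ / 8 by ring]; exact hκ₁
  have h := donut2_connected hR hΔ hnbr hκ' hYne ((P2 R q Z).filter (fun Y₂ => Y ⊆ Y₂)) fun Y₂ hY₂ => by
    rw [mem_filter, mem_P2] at hY₂
    exact ⟨hY₂.2, hY₂.1.1⟩
  rw [show κ₁ / 4 / 2 = κ₁ / 8 by ring] at h
  exact h

omit [NeZero L] [Fintype C] [DecidableEq C] in
/-- *"The second inequality holds since |Y|_{𝛀′} ≤ L³|Z|_{LM}. In the last step we have used the inequality |Z|_{LM} ≤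
𝒪(1)(1 + d_{LM}(Z)) and suppressed the constants by taking M and hence κ₁ large enough"* (L4708–4711): with
`|Y| ≤ L^d|X̄|`, `X̄ ⊆ Z`, the model's `|Z| ≤ 2^d(4d(Z)+1)` and the suppression clause `(Δ+1)e^{−⅛κ₁}L^d·2^{d+2} ≤ 1`
EXPLICIT: `exp((Δ+1)e^{−⅛κ₁}|Y|) ≤ e^{1/4}·e^{d(Z)}`.
[cite: Dimock2013BalabanII, §3.13 Lemma 3.15 proof (F) L4704–4711 (arXiv:1212.5562v2 TeX)] -/
theorem donut_factor_le {κ₁ : ℝ} {Δ : ℕ}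
    (hsup : ((Δ : ℝ) + 1) * exp (-(κ₁ / 8)) * (L : ℝ) ^ d * (2 ^ d * 4) ≤ 1)
    {Y : Finset C} {X : Finset (TPt d (L * N'))} (hvolX : (Y.card : ℝ) ≤ (L : ℝ) ^ d * (bar L N' X).card)
    {Z : Finset (TPt d N')} (hZ : Z ∈ doms d N') (hbarZ : bar L N' X ⊆ Z) :
    exp (exp (-(κ₁ / 8)) * (((Δ : ℝ) + 1) * Y.card)) ≤ exp (1 / 4) * exp (torusTreeLen Z) := by
  rw [← Real.exp_add, Real.exp_le_exp]
  set w := ((Δ : ℝ) + 1) * exp (-(κ₁ / 8)) with hw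
  have hw0 : 0 ≤ w := mul_nonneg (by positivity) (exp_pos _).le
  have hZd := mem_doms.1 hZ
  have hdZ0 : 0 ≤ torusTreeLen Z := torusTreeLen_nonneg Z
  have h1 : ((bar L N' X).card : ℝ) ≤ Z.card := by exact_mod_cast card_le_card hbarZ
  have h2 : (Z.card : ℝ) ≤ 2 ^ d * (4 * torusTreeLen Z + 1) := card_le_torusTreeLen hZd.1 hZd.2
  have hLd : (0 : ℝ) ≤ (L : ℝ) ^ d := by positivity
  have h3 : (Y.card : ℝ) ≤ (L : ℝ) ^ d * (2 ^ d * (4 * torusTreeLen Z + 1)) :=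
    hvolX.trans (mul_le_mul_of_nonneg_left (h1.trans h2) hLd)
  calc exp (-(κ₁ / 8)) * (((Δ : ℝ) + 1) * Y.card) = w * Y.card := by rw [hw]; ring
    _ ≤ w * ((L : ℝ) ^ d * (2 ^ d * (4 * torusTreeLen Z + 1))) := mul_le_mul_of_nonneg_left h3 hw0
    _ = (((Δ : ℝ) + 1) * exp (-(κ₁ / 8)) * (L : ℝ) ^ d * (2 ^ d * 4)) * (torusTreeLen Z + 1 / 4) := by
        rw [hw]; ring
    _ ≤ 1 * (torusTreeLen Z + 1 / 4) := mul_le_mul_of_nonneg_right hsup (by linarith)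
    _ = 1 / 4 + torusTreeLen Z := by ring

/-- THE FINAL `X`-SUM (L4712–4715: *"In the final sum Σ_{Y⊂Z} Σ_{X: X̄=Y} = Σ_{X⊂Z} and Σ_{X⊂Z} e^{−κ_0 d_M(X)} ≤ 𝒪(1)|Z|_M
= 𝒪(1)L³|Z|_{LM}"*): over the `M`-polymers whose `LM`-blocking lies in `Z`, `Σ e^{−κd(X)} ≤ L^d·|Z|·K₀` for `κ ≥ κ₀`
(union bound over the `≤ L^d|Z|` `M`-cubes blocked into `Z`, `Reblocking.card_filter_tcoarse_mem_le`, and (summing0)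
= `Reblocking.sum_domsAt_exp_le`). [cite: Dimock2013BalabanII, §3.13 Lemma 3.15 proof (F) L4712–4715 (arXiv:1212.5562v2 TeX)] -/
theorem sum_bar_subset_exp_le (Z : Finset (TPt d N')) {κ : ℝ} (hκ : kappa₀ (4 * 2 ^ d) (2 * d) ≤ κ) :
    ∑ X ∈ (doms d (L * N')).filter (fun X => bar L N' X ⊆ Z), exp (-κ * torusTreeLen X)
      ≤ (L : ℝ) ^ d * Z.card * K₀ (4 * 2 ^ d) (2 * d) := by
  classical
  set 𝒴 := (doms d (L * N')).filter (fun X => bar L N' X ⊆ Z) with h𝒴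
  set F := univ.filter (fun a : TPt d (L * N') => tcoarse L N' a ∈ Z) with hF
  have hne : ∀ X ∈ 𝒴, (X ∩ F).Nonempty := by
    intro X hX
    rw [h𝒴, mem_filter, mem_doms] at hX
    obtain ⟨⟨⟨c, hc⟩, -⟩, hsub⟩ := hX
    have hcb : tcoarse L N' c ∈ bar L N' X := mem_image_of_mem _ hc
    exact ⟨c, mem_inter.2 ⟨hc, by rw [hF, mem_filter]; exact ⟨mem_univ _, hsub hcb⟩⟩⟩
  have h1 := sum_le_sum_mem 𝒴 F (fun X => exp (-κ * torusTreeLen X)) (fun X _ => (exp_pos _).le) hne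
  have h2 : ∀ c ∈ F, ∑ X ∈ 𝒴.filter (fun X => c ∈ X), exp (-κ * torusTreeLen X)
      ≤ K₀ (4 * 2 ^ d) (2 * d) := by
    intro c _
    refine le_trans (sum_le_sum_of_subset_of_nonneg ?_ fun X _ _ => (exp_pos _).le) (sum_domsAt_exp_le c hκ)
    intro X hX
    rw [mem_filter, h𝒴, mem_filter] at hX
    exact mem_domsAt.2 ⟨hX.2, (mem_doms.1 hX.1.1).2⟩
  have hcard : (F.card : ℝ) ≤ (L : ℝ) ^ d * Z.card := by
    have := card_filter_tcoarse_mem_le (L := L) (N' := N') Z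
    rw [hF]
    exact_mod_cast this
  have hKpos : 0 < K₀ (4 * 2 ^ d) (2 * d) := K₀_pos _ _
  calc ∑ X ∈ 𝒴, exp (-κ * torusTreeLen X)
      ≤ ∑ c ∈ F, ∑ X ∈ 𝒴.filter (fun X => c ∈ X), exp (-κ * torusTreeLen X) := h1
    _ ≤ ∑ _c ∈ F, K₀ (4 * 2 ^ d) (2 * d) := sum_le_sum h2
    _ = (F.card : ℝ) * K₀ (4 * 2 ^ d) (2 * d) := by rw [sum_const, nsmul_eq_mul]
    _ ≤ (L : ℝ) ^ d * Z.card * K₀ (4 * 2 ^ d) (2 * d) := mul_le_mul_of_nonneg_right hcard hKpos.le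

/-- **(snuffit): STEP (F) OF LEMMA 3.15 PROVED** (L4665–4722, concluding *"Then taking L(κ−κ_0)−2 ≥ L(κ−κ_0−2) yields
|(δE^+_k)^{(iv)}(Z)| ≤ 𝒪(1)L³λ_k^{1/4−10ε}e^{−L(κ−κ_0−2)d_{LM}(Z)}"*): on the cell's two nested periodic polymer models
(`M`-cubes `TPt d (L·N′)`, `LM`-cubes `TPt d N′`, block map `Reblocking.bar`) with an ABSTRACT middle carrier of
elementary `𝛀′`-cubes `C` (symmetric adjacency `R` of degree `≤ Δ`, `LM`-blocking `q`, `𝛀′`-blocking `X ↦ barω X` of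
the `M`-polymers with `q(barω X) = X̄` and `|barω X| ≤ L^d|X̄|`), for `κ ≥ κ₀ = κ₀(4·2^d, 2d)` and the three *"M (hence
κ₁ = ½log M) sufficiently large"* clauses EXPLICIT — `L(κ−κ₀) ≤ ½κ₁ − 1` (L4684), `log 2 + 2log(Δ+1) ≤ ⅛κ₁` (App. D at rate
`¼κ₁`, L4703–4705), `(Δ+1)e^{−⅛κ₁}L^d 2^{d+2} ≤ 1` (L4710–4711) — the collected sum satisfies, for every `LM`-polymer `Z`,
`fSum ≤ 2^d·K₀·e^{1/4}·L^d·e^{−(L(κ−κ₀)−5)d(Z)}`: the print's `𝒪(1)L³ e^{−(L(κ−κ_0)−2)d_{LM}(Z)}` with the model's volume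
constant (`|Z| ≤ 2^d(4d(Z)+1)`, offset `5 = 4 + 1` for the printed `2 = 1 + 1`) — DECLARED divergence of constants.
[cite: Dimock2013BalabanII, §3.13 Lemma 3.15 (label first) proof (F) L4665–4722, eqs. (stovepipe), (snuffit) (arXiv:1212.5562v2 TeX)] -/
theorem snuffit {R : C → C → Prop} (hR : ∀ x y, R x y → R y x) {nbr : C → Finset C} {Δ : ℕ}
    (hΔ : ∀ x, (nbr x).card ≤ Δ) (hnbr : ∀ x y, R x y → y ∈ nbr x)
    (q : C → TPt d N') (barω : Finset (TPt d (L * N')) → Finset C) (𝒳 : Finset (Finset (TPt d (L * N'))))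
    (h𝒳 : 𝒳 ⊆ doms d (L * N')) (hq : ∀ X ∈ 𝒳, (barω X).image q = bar L N' X)
    (hvol : ∀ X ∈ 𝒳, ((barω X).card : ℝ) ≤ (L : ℝ) ^ d * (bar L N' X).card)
    {κ κ₁ : ℝ} (hκ : kappa₀ (4 * 2 ^ d) (2 * d) ≤ κ)
    (hM : (L : ℝ) * (κ - kappa₀ (4 * 2 ^ d) (2 * d)) ≤ κ₁ / 2 - 1)
    (hκ₁ : Real.log 2 + 2 * Real.log ((Δ : ℝ) + 1) ≤ κ₁ / 8)
    (hsup : ((Δ : ℝ) + 1) * exp (-(κ₁ / 8)) * (L : ℝ) ^ d * (2 ^ d * 4) ≤ 1)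
    {Z : Finset (TPt d N')} (hZ : Z ∈ doms d N') :
    fSum R q barω 𝒳 κ κ₁ Z ≤ 2 ^ d * K₀ (4 * 2 ^ d) (2 * d) * exp (1 / 4) * (L : ℝ) ^ d *
        exp (-(L * (κ - kappa₀ (4 * 2 ^ d) (2 * d)) - 5) * torusTreeLen Z) := by
  classical
  set κ₀ := kappa₀ (4 * 2 ^ d) (2 * d) with hκ₀
  set K := K₀ (4 * 2 ^ d) (2 * d) with hK
  have hKpos : 0 < K := K₀_pos _ _
  set dZ := torusTreeLen Z with hdZ
  have hdZ0 : 0 ≤ dZ := torusTreeLen_nonneg Z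
  have hlog : Real.log 2 ≤ κ₁ / 4 := by
    have h1 : 0 ≤ Real.log ((Δ : ℝ) + 1) := Real.log_nonneg (by
      have : (0 : ℝ) ≤ Δ := Nat.cast_nonneg _
      linarith)
    have h2 : 0 < Real.log 2 := Real.log_pos one_lt_two
    linarith
  set e1 := exp (-(L * (κ - κ₀)) * dZ) with he1
  set e4 := exp (1 / 4) * exp dZ with he4
  -- the summand after the `Y₁`- and `Y₂`-sums, per `X`
  have hinner : ∀ X ∈ 𝒳.filter (fun X => bar L N' X ⊆ Z),
      ∑ Y₂ ∈ (P2 R q Z).filter (fun Y₂ => barω X ⊆ Y₂), ∑ Y₁ ∈ Finset.Icc (barω X) Y₂,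
          exp (-(κ₁ - 1) * ((Y₂ \ Y₁).card : ℝ)) * exp (-(κ₁ - 1) * ((Y₁ \ barω X).card : ℝ)) *
            exp (-κ * torusTreeLen X)
        ≤ e1 * e4 * exp (-κ₀ * torusTreeLen X) := by
    intro X hX
    obtain ⟨hX𝒳, hbarZ⟩ := mem_filter.1 hX
    have hXd : X ∈ doms d (L * N') := h𝒳 hX𝒳
    have hYne : (barω X).Nonempty := by
      have himg : ((barω X).image q).Nonempty := by
        rw [hq X hX𝒳]
        exact (mem_doms.1 hXd).1.image _
      exact Finset.image_nonempty.1 himg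
    -- the `Y₁`-sums
    have s1 : ∑ Y₂ ∈ (P2 R q Z).filter (fun Y₂ => barω X ⊆ Y₂), ∑ Y₁ ∈ Finset.Icc (barω X) Y₂,
          exp (-(κ₁ - 1) * ((Y₂ \ Y₁).card : ℝ)) * exp (-(κ₁ - 1) * ((Y₁ \ barω X).card : ℝ)) *
            exp (-κ * torusTreeLen X)
        ≤ ∑ Y₂ ∈ (P2 R q Z).filter (fun Y₂ => barω X ⊆ Y₂),
            e1 * (exp (-(κ₁ / 4) * ((Y₂ \ barω X).card : ℝ)) * exp (-κ₀ * torusTreeLen X)) := by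
      refine sum_le_sum fun Y₂ hY₂ => ?_
      rw [mem_filter, mem_P2] at hY₂
      exact sum_Icc_le hκ hM hlog q hXd (hq X hX𝒳) hY₂.2 hZ hY₂.1.2
    -- factor and apply LEMMA D.2
    have s2 : ∑ Y₂ ∈ (P2 R q Z).filter (fun Y₂ => barω X ⊆ Y₂),
          e1 * (exp (-(κ₁ / 4) * ((Y₂ \ barω X).card : ℝ)) * exp (-κ₀ * torusTreeLen X))
        = e1 * exp (-κ₀ * torusTreeLen X) *
            ∑ Y₂ ∈ (P2 R q Z).filter (fun Y₂ => barω X ⊆ Y₂), exp (-(κ₁ / 4) * ((Y₂ \ barω X).card : ℝ)) := by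
      rw [mul_sum]
      refine sum_congr rfl fun Y₂ _ => ?_
      ring
    have s3 := sum_P2_le hR hΔ hnbr hκ₁ q hYne Z
    have s4 := donut_factor_le (N' := N') hsup (hvol X hX𝒳) hZ hbarZ
    have hpos : 0 ≤ e1 * exp (-κ₀ * torusTreeLen X) := mul_nonneg (exp_pos _).le (exp_pos _).le
    calc _ ≤ _ := s1
      _ = _ := s2
      _ ≤ e1 * exp (-κ₀ * torusTreeLen X) * exp (exp (-(κ₁ / 8)) * (((Δ : ℝ) + 1) * (barω X).card)) :=
          mul_le_mul_of_nonneg_left s3 hpos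
      _ ≤ e1 * exp (-κ₀ * torusTreeLen X) * e4 := mul_le_mul_of_nonneg_left s4 hpos
      _ = e1 * e4 * exp (-κ₀ * torusTreeLen X) := by ring
  -- the `X`-sum
  have hX1 : ∑ X ∈ 𝒳.filter (fun X => bar L N' X ⊆ Z), e1 * e4 * exp (-κ₀ * torusTreeLen X)
      = e1 * e4 * ∑ X ∈ 𝒳.filter (fun X => bar L N' X ⊆ Z), exp (-κ₀ * torusTreeLen X) := by
    rw [mul_sum]
  have hX2 : ∑ X ∈ 𝒳.filter (fun X => bar L N' X ⊆ Z), exp (-κ₀ * torusTreeLen X)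
      ≤ ∑ X ∈ (doms d (L * N')).filter (fun X => bar L N' X ⊆ Z), exp (-κ₀ * torusTreeLen X) := by
    refine sum_le_sum_of_subset_of_nonneg ?_ fun X _ _ => (exp_pos _).le
    intro X hX
    rw [mem_filter] at hX ⊢
    exact ⟨h𝒳 hX.1, hX.2⟩
  have hX3 := sum_bar_subset_exp_le (L := L) (N' := N') Z (le_of_eq hκ₀.symm)
  have h4 : (Z.card : ℝ) ≤ 2 ^ d * exp (4 * dZ) := by
    have hZd := mem_doms.1 hZ
    have hv := card_le_torusTreeLen hZd.1 hZd.2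
    have he : 4 * dZ + 1 ≤ exp (4 * dZ) := Real.add_one_le_exp _
    calc (Z.card : ℝ) ≤ 2 ^ d * (4 * dZ + 1) := hv
      _ ≤ 2 ^ d * exp (4 * dZ) := mul_le_mul_of_nonneg_left he (by positivity)
  have he14 : 0 ≤ e1 * e4 := mul_nonneg (exp_pos _).le (mul_nonneg (exp_pos _).le (exp_pos _).le)
  have hLd : (0 : ℝ) ≤ (L : ℝ) ^ d := by positivity
  rw [fSum_eq R q barω 𝒳 hq κ κ₁ Z]
  calc _ ≤ ∑ X ∈ 𝒳.filter (fun X => bar L N' X ⊆ Z), e1 * e4 * exp (-κ₀ * torusTreeLen X) := sum_le_sum hinner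
    _ = e1 * e4 * ∑ X ∈ 𝒳.filter (fun X => bar L N' X ⊆ Z), exp (-κ₀ * torusTreeLen X) := hX1
    _ ≤ e1 * e4 * ∑ X ∈ (doms d (L * N')).filter (fun X => bar L N' X ⊆ Z), exp (-κ₀ * torusTreeLen X) :=
        mul_le_mul_of_nonneg_left hX2 he14
    _ ≤ e1 * e4 * ((L : ℝ) ^ d * Z.card * K) := mul_le_mul_of_nonneg_left hX3 he14
    _ ≤ e1 * e4 * ((L : ℝ) ^ d * (2 ^ d * exp (4 * dZ)) * K) := by
        refine mul_le_mul_of_nonneg_left ?_ he14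
        exact mul_le_mul_of_nonneg_right (mul_le_mul_of_nonneg_left h4 hLd) hKpos.le
    _ = 2 ^ d * K * exp (1 / 4) * (L : ℝ) ^ d * (exp (-(L * (κ - κ₀)) * dZ) * exp dZ * exp (4 * dZ)) := by
        rw [he1, he4]; ring
    _ = 2 ^ d * K * exp (1 / 4) * (L : ℝ) ^ d * exp (-(L * (κ - κ₀) - 5) * dZ) := by
        rw [← Real.exp_add, ← Real.exp_add]; ring_nf

/-- **(snuffit) IN THE PRINTED SHAPE** (L4716–4721: *"Then taking L(κ−κ_0)−2 ≥ L(κ−κ_0−2) yields |(δE^+_k)^{(iv)}(Z)| ≤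
𝒪(1)L³λ_k^{1/4−10ε}e^{−L(κ−κ_0−2)d_{LM}(Z)}"*): for `L ≥ 3` the model's offset is covered (`L(κ−κ₀) − 5 ≥ L(κ−κ₀−2)`)
and `fSum ≤ 2^d·K₀·e^{1/4}·L^d·e^{−L(κ−κ₀−2)d(Z)}` — EXACTLY the shape of the hypothesis `hf` of `ActiveBoundaryTerms`
((E)–(H): rate `a + κ₀ = L(κ−κ₀−2)`, constant `c = 𝒪(1)L³λ_k^{1/4−10ε}`).
[cite: Dimock2013BalabanII, §3.13 Lemma 3.15 (label first) eq. (snuffit) L4716–4721 (arXiv:1212.5562v2 TeX)] -/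
theorem snuffit_printed {R : C → C → Prop} (hR : ∀ x y, R x y → R y x) {nbr : C → Finset C} {Δ : ℕ}
    (hΔ : ∀ x, (nbr x).card ≤ Δ) (hnbr : ∀ x y, R x y → y ∈ nbr x)
    (q : C → TPt d N') (barω : Finset (TPt d (L * N')) → Finset C) (𝒳 : Finset (Finset (TPt d (L * N'))))
    (h𝒳 : 𝒳 ⊆ doms d (L * N')) (hq : ∀ X ∈ 𝒳, (barω X).image q = bar L N' X)
    (hvol : ∀ X ∈ 𝒳, ((barω X).card : ℝ) ≤ (L : ℝ) ^ d * (bar L N' X).card)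
    {κ κ₁ : ℝ} (hκ : kappa₀ (4 * 2 ^ d) (2 * d) ≤ κ) (hL3 : 3 ≤ L)
    (hM : (L : ℝ) * (κ - kappa₀ (4 * 2 ^ d) (2 * d)) ≤ κ₁ / 2 - 1)
    (hκ₁ : Real.log 2 + 2 * Real.log ((Δ : ℝ) + 1) ≤ κ₁ / 8)
    (hsup : ((Δ : ℝ) + 1) * exp (-(κ₁ / 8)) * (L : ℝ) ^ d * (2 ^ d * 4) ≤ 1)
    {Z : Finset (TPt d N')} (hZ : Z ∈ doms d N') :
    fSum R q barω 𝒳 κ κ₁ Z ≤ 2 ^ d * K₀ (4 * 2 ^ d) (2 * d) * exp (1 / 4) * (L : ℝ) ^ d *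
        exp (-(L * (κ - kappa₀ (4 * 2 ^ d) (2 * d) - 2)) * torusTreeLen Z) := by
  have h := snuffit hR hΔ hnbr q barω 𝒳 h𝒳 hq hvol hκ hM hκ₁ hsup hZ
  refine h.trans (mul_le_mul_of_nonneg_left ?_ ?_)
  · rw [Real.exp_le_exp]
    have hL3r : (3 : ℝ) ≤ L := by exact_mod_cast hL3
    have hdZ0 : 0 ≤ torusTreeLen Z := torusTreeLen_nonneg Z
    have hk : (L : ℝ) * (κ - kappa₀ (4 * 2 ^ d) (2 * d) - 2) ≤ L * (κ - kappa₀ (4 * 2 ^ d) (2 * d)) - 5 := by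
      nlinarith
    nlinarith
  · have := K₀_pos (4 * 2 ^ d) (2 * d)
    positivity

/-! ### Non-vacuity of the three-level hypotheses -/

omit [NeZero N'] in
/-- THE HYPOTHESES ON THE MIDDLE CARRIER ARE INHABITED: with `𝛀′` = all `LM`-cubes (`Ω_{k+1}` everything: `C` = the
coarse torus, `q = id`, `barω = Reblocking.bar`) both `q(barω X) = X̄` and `|barω X| ≤ L^d|X̄|` hold. [folklore] -/
example (X : Finset (TPt d (L * N'))) :
    (bar L N' X).image id = bar L N' X ∧ ((bar L N' X).card : ℝ) ≤ (L : ℝ) ^ d * (bar L N' X).card := by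
  refine ⟨image_id, ?_⟩
  have hL : (1 : ℝ) ≤ (L : ℝ) ^ d := one_le_pow₀ (by exact_mod_cast Nat.one_le_iff_ne_zero.2 (NeZero.ne L))
  have hc : (0 : ℝ) ≤ (bar L N' X).card := Nat.cast_nonneg _
  nlinarith

end PartII

/-- THE THREE «M SUFFICIENTLY LARGE» CLAUSES OF (F) ARE JOINTLY SATISFIABLE: `d = 3`, `Δ = 6` (common-wall adjacency of
`M`-cubes), `L = 3`, `κ = κ₀` and `κ₁ = 80` (i.e. `M = e^{160}`). [folklore] -/
example : ((3 : ℕ) : ℝ) * (kappa₀ (4 * 2 ^ 3) (2 * 3) - kappa₀ (4 * 2 ^ 3) (2 * 3)) ≤ (80 : ℝ) / 2 - 1 ∧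
    Real.log 2 + 2 * Real.log (((6 : ℕ) : ℝ) + 1) ≤ (80 : ℝ) / 8 ∧
    (((6 : ℕ) : ℝ) + 1) * exp (-((80 : ℝ) / 8)) * ((3 : ℕ) : ℝ) ^ 3 * (2 ^ 3 * 4) ≤ 1 := by
  have e7 : (((6 : ℕ) : ℝ) + 1) = 7 := by norm_num
  refine ⟨by rw [sub_self, mul_zero]; norm_num, ?_, ?_⟩
  · have h2 : Real.log 2 < 7 / 10 := Real.log_two_lt_d9.trans_le (by norm_num)
    have h7 : Real.log 7 ≤ 2 := by
      rw [Real.log_le_iff_le_exp (by norm_num : (0 : ℝ) < 7)]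
      have he : (27 / 10 : ℝ) < exp 1 := lt_trans (by norm_num) Real.exp_one_gt_d9
      have h2e : exp 2 = exp 1 ^ 2 := by rw [← Real.exp_nat_mul]; norm_num
      rw [h2e]
      nlinarith
    rw [e7]
    linarith
  · have he : (27 / 10 : ℝ) < exp 1 := lt_trans (by norm_num) Real.exp_one_gt_d9
    have h10 : exp (10 : ℝ) = exp 1 ^ 10 := by rw [← Real.exp_nat_mul]; norm_num
    have hbig : (6048 : ℝ) ≤ exp 10 := by
      rw [h10]
      have h27 : (27 / 10 : ℝ) ^ 10 ≤ exp 1 ^ 10 := pow_le_pow_left₀ (by norm_num) he.le 10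
      refine le_trans ?_ h27
      norm_num
    rw [e7, show -((80 : ℝ) / 8) = -10 by norm_num, Real.exp_neg]
    have hpos : 0 < exp (10 : ℝ) := exp_pos _
    rw [show (7 : ℝ) * (exp 10)⁻¹ * ((3 : ℕ) : ℝ) ^ 3 * (2 ^ 3 * 4) = 6048 * (exp 10)⁻¹ by push_cast; ring]
    rw [← div_eq_mul_inv, div_le_one hpos]
    exact hbig

/-! ## Part 3 (v1.1). The two extreme instances of the middle carrier on the cell's tori: `𝛀′` = all `LM`-cubes
(`C` = the coarse torus, `q = id`, `barω = bar`) and `𝛀′` = all `M`-cubes (`C` = the fine torus, `q = tcoarse`,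
`barω = id`); in both the elementary-cube adjacency is the common-wall adjacency `TAdj` of degree `≤ 2d` -/

section Instances

variable {L N' : ℕ} [NeZero L] [NeZero N']

omit [NeZero N'] in
/-- `𝛀′` = all `LM`-cubes: the `𝛀′`-blocking of an `M`-polymer IS its `LM`-blocking, and *"|Y|_{𝛀′} ≤ L³|Z|_{LM}"* is
`|X̄| ≤ L^d|X̄|`. [cite: Dimock2013BalabanII, §3.13 Lemma 3.15 proof (F) L4676 and L4708 (arXiv:1212.5562v2 TeX)] -/
theorem middle_LM (X : Finset (TPt d (L * N'))) :
    (bar L N' X).image id = bar L N' X ∧ ((bar L N' X).card : ℝ) ≤ (L : ℝ) ^ d * (bar L N' X).card := by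
  refine ⟨image_id, ?_⟩
  have hL : (1 : ℝ) ≤ (L : ℝ) ^ d := one_le_pow₀ (by exact_mod_cast Nat.one_le_iff_ne_zero.2 (NeZero.ne L))
  have hc : (0 : ℝ) ≤ (bar L N' X).card := Nat.cast_nonneg _
  nlinarith

/-- `𝛀′` = all `M`-cubes: the `𝛀′`-blocking is the identity, its `LM`-blocking is `X̄ = bar` by definition, and
*"|Y|_{𝛀′} ≤ L³|Z|_{LM}"* is *"|Y|_M = L³|Y|_{LM}"*: `|X| ≤ L^d|X̄|` (`Reblocking.card_filter_tcoarse_mem_le`).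
[cite: Dimock2013BalabanII, §3.13 Lemma 3.15 proof (F) L4676, L4708 and L4712–4714 (arXiv:1212.5562v2 TeX)] -/
theorem middle_M (X : Finset (TPt d (L * N'))) :
    X.image (tcoarse L N') = bar L N' X ∧ (X.card : ℝ) ≤ (L : ℝ) ^ d * (bar L N' X).card := by
  classical
  refine ⟨rfl, ?_⟩
  have h1 : X ⊆ univ.filter (fun a : TPt d (L * N') => tcoarse L N' a ∈ bar L N' X) := by
    intro a ha
    rw [mem_filter]
    exact ⟨mem_univ _, mem_image_of_mem _ ha⟩
  have h2 := card_filter_tcoarse_mem_le (L := L) (N' := N') (bar L N' X)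
  exact_mod_cast (card_le_card h1).trans h2

/-- **(snuffit) WITH `𝛀′` = ALL `LM`-CUBES**, fully concrete on the two tori: `Y = X̄`, `Y₁`, `Y₂` range over families of
`LM`-cubes (`Y₂` torus-face-connected with `Y₂ = Z`), `Δ = 2d`; for `L ≥ 3` and the three «M large» clauses,
`fSum ≤ 2^d·K₀·e^{1/4}·L^d·e^{−L(κ−κ₀−2)d(Z)}`.
[cite: Dimock2013BalabanII, §3.13 Lemma 3.15 (label first) proof (F) L4665–4722, eq. (snuffit) (arXiv:1212.5562v2 TeX)] -/
theorem snuffit_LM (𝒳 : Finset (Finset (TPt d (L * N')))) (h𝒳 : 𝒳 ⊆ doms d (L * N'))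
    {κ κ₁ : ℝ} (hκ : kappa₀ (4 * 2 ^ d) (2 * d) ≤ κ) (hL3 : 3 ≤ L)
    (hM : (L : ℝ) * (κ - kappa₀ (4 * 2 ^ d) (2 * d)) ≤ κ₁ / 2 - 1)
    (hκ₁ : Real.log 2 + 2 * Real.log (2 * (d : ℝ) + 1) ≤ κ₁ / 8)
    (hsup : (2 * (d : ℝ) + 1) * exp (-(κ₁ / 8)) * (L : ℝ) ^ d * (2 ^ d * 4) ≤ 1)
    {Z : Finset (TPt d N')} (hZ : Z ∈ doms d N') :
    fSum (TAdj (d := d) (N := N')) id (bar L N') 𝒳 κ κ₁ Z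
      ≤ 2 ^ d * K₀ (4 * 2 ^ d) (2 * d) * exp (1 / 4) * (L : ℝ) ^ d *
        exp (-(L * (κ - kappa₀ (4 * 2 ^ d) (2 * d) - 2)) * torusTreeLen Z) := by
  have hκ₁' : Real.log 2 + 2 * Real.log (((2 * d : ℕ) : ℝ) + 1) ≤ κ₁ / 8 := by push_cast; exact hκ₁
  have hsup' : (((2 * d : ℕ) : ℝ) + 1) * exp (-(κ₁ / 8)) * (L : ℝ) ^ d * (2 ^ d * 4) ≤ 1 := by push_cast; exact hsup
  exact snuffit_printed ConnectedPolymerSums.tadj_symm' ConnectedPolymerSums.card_tnbr_le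
    ConnectedPolymerSums.mem_tnbr_of_tadj id (bar L N') 𝒳 h𝒳 (fun X _ => (middle_LM X).1)
    (fun X _ => (middle_LM X).2) hκ hL3 hM hκ₁' hsup' hZ

/-- **(snuffit) WITH `𝛀′` = ALL `M`-CUBES**, fully concrete on the two tori: `Y = X`, `Y₁`, `Y₂` range over families of
`M`-cubes (`Y₂` torus-face-connected with `Ȳ₂ = Z`), `Δ = 2d`; for `L ≥ 3` and the three «M large» clauses,
`fSum ≤ 2^d·K₀·e^{1/4}·L^d·e^{−L(κ−κ₀−2)d(Z)}`.
[cite: Dimock2013BalabanII, §3.13 Lemma 3.15 (label first) proof (F) L4665–4722, eq. (snuffit) (arXiv:1212.5562v2 TeX)] -/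
theorem snuffit_M (𝒳 : Finset (Finset (TPt d (L * N')))) (h𝒳 : 𝒳 ⊆ doms d (L * N'))
    {κ κ₁ : ℝ} (hκ : kappa₀ (4 * 2 ^ d) (2 * d) ≤ κ) (hL3 : 3 ≤ L)
    (hM : (L : ℝ) * (κ - kappa₀ (4 * 2 ^ d) (2 * d)) ≤ κ₁ / 2 - 1)
    (hκ₁ : Real.log 2 + 2 * Real.log (2 * (d : ℝ) + 1) ≤ κ₁ / 8)
    (hsup : (2 * (d : ℝ) + 1) * exp (-(κ₁ / 8)) * (L : ℝ) ^ d * (2 ^ d * 4) ≤ 1)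
    {Z : Finset (TPt d N')} (hZ : Z ∈ doms d N') :
    fSum (TAdj (d := d) (N := L * N')) (tcoarse L N') id 𝒳 κ κ₁ Z
      ≤ 2 ^ d * K₀ (4 * 2 ^ d) (2 * d) * exp (1 / 4) * (L : ℝ) ^ d *
        exp (-(L * (κ - kappa₀ (4 * 2 ^ d) (2 * d) - 2)) * torusTreeLen Z) := by
  have hκ₁' : Real.log 2 + 2 * Real.log (((2 * d : ℕ) : ℝ) + 1) ≤ κ₁ / 8 := by push_cast; exact hκ₁
  have hsup' : (((2 * d : ℕ) : ℝ) + 1) * exp (-(κ₁ / 8)) * (L : ℝ) ^ d * (2 ^ d * 4) ≤ 1 := by push_cast; exact hsup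
  exact snuffit_printed ConnectedPolymerSums.tadj_symm' ConnectedPolymerSums.card_tnbr_le
    ConnectedPolymerSums.mem_tnbr_of_tadj (tcoarse L N') id 𝒳 h𝒳
    (fun X _ => (middle_M X).1) (fun X _ => (middle_M X).2) hκ hL3 hM hκ₁' hsup' hZ

end Instances

/-! ## Part 4 (v1.1). The Summary's common rate: *"(relaxing the bounds a bit) … e^{−L(κ−3κ₀−3)d_{LM}(Y)}"* -/

/-- THE SUMMARY'S RELAXATION (L5378–5412: *"Inserting the results of the last three lemmas … (relaxing the bounds a bit)
satisfies there |(δE^+_k)^{loc}(Y)| ≤ 𝒪(1)L³λ_k^{1/4−10ε}e^{−L(κ−3κ_0−3)d_{LM}(Y)}"*, likewise for `R^{loc}` and `B^{loc}`):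
each of the four rates printed by LEMMAS 3.15–3.17 — `L(κ−2κ₀−2)` ((δE^+_k)^{loc}), `L(κ−κ₀−2)` (R^{loc}, (lulu0)),
`L(κ−2κ₀−3)` (B^{(E)}, B^{(R)}), `L(κ−κ₀−3)` (B^{(B)}) — dominates the common rate `L(κ−3κ₀−3)` for `κ₀, L, d(Y) ≥ 0`.
[cite: Dimock2013BalabanII, §3.13 Summary L5378–5412 (arXiv:1212.5562v2 TeX)] -/
theorem summary_rates {κ κ₀ L t : ℝ} (hκ₀ : 0 ≤ κ₀) (hL : 0 ≤ L) (ht : 0 ≤ t) :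
    exp (-(L * (κ - 2 * κ₀ - 2)) * t) ≤ exp (-(L * (κ - 3 * κ₀ - 3)) * t) ∧
    exp (-(L * (κ - κ₀ - 2)) * t) ≤ exp (-(L * (κ - 3 * κ₀ - 3)) * t) ∧
    exp (-(L * (κ - 2 * κ₀ - 3)) * t) ≤ exp (-(L * (κ - 3 * κ₀ - 3)) * t) ∧
    exp (-(L * (κ - κ₀ - 3)) * t) ≤ exp (-(L * (κ - 3 * κ₀ - 3)) * t) := by
  have hLt : 0 ≤ L * t := mul_nonneg hL ht
  refine ⟨?_, ?_, ?_, ?_⟩ <;> rw [Real.exp_le_exp] <;> nlinarith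

/-! ## Part 5 (v1.2). LEMMA 3.16 (`second`), the term `R^{(0)}`: the single-decoupling three-fold sum
(sunstroke) → (x2), *"estimated just as in part (F.) of the previous lemma, except that now there is just a sum over Y₁
instead of Y₁, Y₂"* -/

section LemmaSecond

variable {L N' : ℕ} [NeZero L] [NeZero N']
variable {C : Type*} [Fintype C] [DecidableEq C]

/-- **THE COLLECTED SUM OF LEMMA 3.16's `R^{(0)}` TERM** (L4913–4921: *"|R‴_{k,𝚷⁺}(Z)| ≤ 𝒪(1)λ_k^{n_0} Σ_{Y_1: Ȳ_1=Z}
Σ_{Y⊂Y_1} Σ_{X: X̄=Y} exp(−(κ_1−1)|Y_1−Y|_{𝛀′} − κd_M(X))"*): the three-fold analogue of `fSum` (one decoupling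
expansion (x1) instead of two), indexed by the pairs `(Y₁, X)` with `Y = X̄^{𝛀′} = barω X ⊆ Y₁`, `Y₁` connected with
`Ȳ₁ = Z`. [cite: Dimock2013BalabanII, §3.13 Lemma 3.16 (label second) proof L4873–4921, eqs. (x1), (sunstroke) (arXiv:1212.5562v2 TeX)] -/
def fSum1 (R : C → C → Prop) (q : C → TPt d N') (barω : Finset (TPt d (L * N')) → Finset C)
    (𝒳 : Finset (Finset (TPt d (L * N')))) (κ κ₁ : ℝ) (Z : Finset (TPt d N')) : ℝ :=
  ∑ Y₁ ∈ P2 R q Z, ∑ X ∈ 𝒳.filter (fun X => barω X ⊆ Y₁),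
    exp (-(κ₁ - 1) * ((Y₁ \ barω X).card : ℝ)) * exp (-κ * torusTreeLen X)

omit [Fintype C] in
/-- THE TERMWISE EXTRACTION FOR THE THREE-FOLD SUM: `stovepipe_term` with the middle set equal to `Y`
(`|Y − Y| = 0`): `e^{−(κ₁−1)|Y₁−Y|}e^{−κd(X)} ≤ e^{−L(κ−κ₀)d(Z)}·e^{−½κ₁|Y₁−Y|}·e^{−κ₀d(X)}`.
[cite: Dimock2013BalabanII, §3.13 Lemma 3.16 (label second) proof L4922 «just as in part (F.)» with Lemma 3.15 proof (F) L4676–4692 (arXiv:1212.5562v2 TeX)] -/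
theorem stovepipe_term1 {κ κ₁ : ℝ} (hκ : kappa₀ (4 * 2 ^ d) (2 * d) ≤ κ)
    (hM : (L : ℝ) * (κ - kappa₀ (4 * 2 ^ d) (2 * d)) ≤ κ₁ / 2 - 1)
    (q : C → TPt d N') {X : Finset (TPt d (L * N'))} (hX : X ∈ doms d (L * N'))
    {Y Y₁ : Finset C} (hYq : Y.image q = bar L N' X) (h1 : Y ⊆ Y₁)
    {Z : Finset (TPt d N')} (hZ : Z ∈ doms d N') (hY₁q : Y₁.image q = Z) :
    exp (-(κ₁ - 1) * ((Y₁ \ Y).card : ℝ)) * exp (-κ * torusTreeLen X)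
      ≤ exp (-(L * (κ - kappa₀ (4 * 2 ^ d) (2 * d))) * torusTreeLen Z) *
        (exp (-(κ₁ / 2) * ((Y₁ \ Y).card : ℝ)) * exp (-kappa₀ (4 * 2 ^ d) (2 * d) * torusTreeLen X)) := by
  have h := stovepipe_term hκ hM q hX hYq (subset_refl Y) h1 hZ hY₁q
  have h0 : exp (-(κ₁ - 1) * ((Y \ Y).card : ℝ)) = 1 := by
    rw [sdiff_self, Finset.bot_eq_empty, card_empty, Nat.cast_zero, mul_zero, Real.exp_zero]
  rw [h0, mul_one] at h
  exact h

omit [NeZero L] [NeZero N'] in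
/-- THE EXCHANGE for the three-fold sum: `Σ_{Y₁: Ȳ₁=Z} Σ_{X: X̄⊆Y₁} = Σ_{X: X̄⊆Z} Σ_{Y₁⊇X̄, Ȳ₁=Z}`.
[cite: Dimock2013BalabanII, §3.13 Lemma 3.16 (label second) proof L4922 with Lemma 3.15 proof (F) L4704 (arXiv:1212.5562v2 TeX)] -/
theorem fSum1_eq (R : C → C → Prop) (q : C → TPt d N') (barω : Finset (TPt d (L * N')) → Finset C)
    (𝒳 : Finset (Finset (TPt d (L * N')))) (hq : ∀ X ∈ 𝒳, (barω X).image q = bar L N' X) (κ κ₁ : ℝ)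
    (Z : Finset (TPt d N')) :
    fSum1 R q barω 𝒳 κ κ₁ Z
      = ∑ X ∈ 𝒳.filter (fun X => bar L N' X ⊆ Z), ∑ Y₁ ∈ (P2 R q Z).filter (fun Y₁ => barω X ⊆ Y₁),
          exp (-(κ₁ - 1) * ((Y₁ \ barω X).card : ℝ)) * exp (-κ * torusTreeLen X) := by
  unfold fSum1
  refine sum_comm' ?_
  intro Y₁ X
  simp only [mem_filter]
  constructor
  · rintro ⟨hY₁, hX, hsub⟩
    refine ⟨⟨hY₁, hsub⟩, hX, ?_⟩
    rw [← hq X hX, ← (mem_P2.1 hY₁).2]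
    exact image_subset_image hsub
  · rintro ⟨⟨hY₁, hsub⟩, hX, -⟩
    exact ⟨hY₁, hX, hsub⟩

/-- **(x2): LEMMA 3.16's `R^{(0)}` SUMMATION PROVED** (L4922–4926: *"This is estimated just as in part (F.) of the previous
lemma, except that now there is just a sum over Y_1 instead of Y_1, Y_2. The result is |R‴_{k,𝚷⁺}(Z)| ≤
𝒪(1)L³λ_k^{n_0}e^{−L(κ−κ_0−2)d_{LM}(Z)}"*): under the same setting and clauses as `snuffit` (the user multiplies by
`𝒪(1)λ_k^{n_0}`), `fSum1 ≤ 2^d·K₀·e^{1/4}·L^d·e^{−(L(κ−κ₀)−5)d(Z)}` — the `Y₁`-sum at rate `½κ₁` by LEMMA D.2 (the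
clause `log 2 + 2log(Δ+1) ≤ ⅛κ₁` a fortiori), the `X`-sum by `sum_bar_subset_exp_le`.
[cite: Dimock2013BalabanII, §3.13 Lemma 3.16 (label second) proof L4913–4926, eq. (x2) (arXiv:1212.5562v2 TeX)] -/
theorem x2 {R : C → C → Prop} (hR : ∀ x y, R x y → R y x) {nbr : C → Finset C} {Δ : ℕ}
    (hΔ : ∀ x, (nbr x).card ≤ Δ) (hnbr : ∀ x y, R x y → y ∈ nbr x)
    (q : C → TPt d N') (barω : Finset (TPt d (L * N')) → Finset C) (𝒳 : Finset (Finset (TPt d (L * N'))))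
    (h𝒳 : 𝒳 ⊆ doms d (L * N')) (hq : ∀ X ∈ 𝒳, (barω X).image q = bar L N' X)
    (hvol : ∀ X ∈ 𝒳, ((barω X).card : ℝ) ≤ (L : ℝ) ^ d * (bar L N' X).card)
    {κ κ₁ : ℝ} (hκ : kappa₀ (4 * 2 ^ d) (2 * d) ≤ κ)
    (hM : (L : ℝ) * (κ - kappa₀ (4 * 2 ^ d) (2 * d)) ≤ κ₁ / 2 - 1)
    (hκ₁ : Real.log 2 + 2 * Real.log ((Δ : ℝ) + 1) ≤ κ₁ / 8)
    (hsup : ((Δ : ℝ) + 1) * exp (-(κ₁ / 8)) * (L : ℝ) ^ d * (2 ^ d * 4) ≤ 1)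
    {Z : Finset (TPt d N')} (hZ : Z ∈ doms d N') :
    fSum1 R q barω 𝒳 κ κ₁ Z ≤ 2 ^ d * K₀ (4 * 2 ^ d) (2 * d) * exp (1 / 4) * (L : ℝ) ^ d *
        exp (-(L * (κ - kappa₀ (4 * 2 ^ d) (2 * d)) - 5) * torusTreeLen Z) := by
  classical
  set κ₀ := kappa₀ (4 * 2 ^ d) (2 * d) with hκ₀
  set K := K₀ (4 * 2 ^ d) (2 * d) with hK
  have hKpos : 0 < K := K₀_pos _ _
  set dZ := torusTreeLen Z with hdZ
  have hdZ0 : 0 ≤ dZ := torusTreeLen_nonneg Z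
  have hlog2 : 0 < Real.log 2 := Real.log_pos one_lt_two
  have hlogΔ : 0 ≤ Real.log ((Δ : ℝ) + 1) := Real.log_nonneg (by
    have : (0 : ℝ) ≤ Δ := Nat.cast_nonneg _
    linarith)
  have hκ₁pos : 0 ≤ κ₁ := by linarith
  -- LEMMA D.2 at rate ½κ₁: its clause holds a fortiori
  have hκ₁half : Real.log 2 + 2 * Real.log ((Δ : ℝ) + 1) ≤ κ₁ / 2 / 2 := by
    rw [show κ₁ / 2 / 2 = κ₁ / 4 by ring]; linarith
  set e1 := exp (-(L * (κ - κ₀)) * dZ) with he1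
  set e4 := exp (1 / 4) * exp dZ with he4
  have hinner : ∀ X ∈ 𝒳.filter (fun X => bar L N' X ⊆ Z),
      ∑ Y₁ ∈ (P2 R q Z).filter (fun Y₁ => barω X ⊆ Y₁),
          exp (-(κ₁ - 1) * ((Y₁ \ barω X).card : ℝ)) * exp (-κ * torusTreeLen X)
        ≤ e1 * e4 * exp (-κ₀ * torusTreeLen X) := by
    intro X hX
    obtain ⟨hX𝒳, hbarZ⟩ := mem_filter.1 hX
    have hXd : X ∈ doms d (L * N') := h𝒳 hX𝒳
    have hYne : (barω X).Nonempty := by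
      have himg : ((barω X).image q).Nonempty := by
        rw [hq X hX𝒳]
        exact (mem_doms.1 hXd).1.image _
      exact Finset.image_nonempty.1 himg
    have s1 : ∑ Y₁ ∈ (P2 R q Z).filter (fun Y₁ => barω X ⊆ Y₁),
          exp (-(κ₁ - 1) * ((Y₁ \ barω X).card : ℝ)) * exp (-κ * torusTreeLen X)
        ≤ ∑ Y₁ ∈ (P2 R q Z).filter (fun Y₁ => barω X ⊆ Y₁),
            e1 * (exp (-(κ₁ / 2) * ((Y₁ \ barω X).card : ℝ)) * exp (-κ₀ * torusTreeLen X)) := by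
      refine sum_le_sum fun Y₁ hY₁ => ?_
      rw [mem_filter, mem_P2] at hY₁
      exact stovepipe_term1 hκ hM q hXd (hq X hX𝒳) hY₁.2 hZ hY₁.1.2
    have s2 : ∑ Y₁ ∈ (P2 R q Z).filter (fun Y₁ => barω X ⊆ Y₁),
          e1 * (exp (-(κ₁ / 2) * ((Y₁ \ barω X).card : ℝ)) * exp (-κ₀ * torusTreeLen X))
        = e1 * exp (-κ₀ * torusTreeLen X) *
            ∑ Y₁ ∈ (P2 R q Z).filter (fun Y₁ => barω X ⊆ Y₁), exp (-(κ₁ / 2) * ((Y₁ \ barω X).card : ℝ)) := by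
      rw [mul_sum]
      refine sum_congr rfl fun Y₁ _ => ?_
      ring
    -- the `Y₁`-sum by LEMMA D.2 at rate ½κ₁
    have s3 : ∑ Y₁ ∈ (P2 R q Z).filter (fun Y₁ => barω X ⊆ Y₁), exp (-(κ₁ / 2) * ((Y₁ \ barω X).card : ℝ))
        ≤ exp (exp (-(κ₁ / 2 / 2)) * (((Δ : ℝ) + 1) * (barω X).card)) :=
      donut2_connected hR hΔ hnbr hκ₁half hYne ((P2 R q Z).filter (fun Y₁ => barω X ⊆ Y₁)) fun Y₁ hY₁ => by
        rw [mem_filter, mem_P2] at hY₁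
        exact ⟨hY₁.2, hY₁.1.1⟩
    -- `e^{−¼κ₁} ≤ e^{−⅛κ₁}`, then the suppression clause
    have s3' : exp (exp (-(κ₁ / 2 / 2)) * (((Δ : ℝ) + 1) * (barω X).card))
        ≤ exp (exp (-(κ₁ / 8)) * (((Δ : ℝ) + 1) * (barω X).card)) := by
      refine Real.exp_le_exp.2 (mul_le_mul_of_nonneg_right (Real.exp_le_exp.2 (by linarith)) ?_)
      have : (0 : ℝ) ≤ (barω X).card := Nat.cast_nonneg _
      positivity
    have s4 := donut_factor_le (N' := N') hsup (hvol X hX𝒳) hZ hbarZ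
    have hpos : 0 ≤ e1 * exp (-κ₀ * torusTreeLen X) := mul_nonneg (exp_pos _).le (exp_pos _).le
    calc _ ≤ _ := s1
      _ = _ := s2
      _ ≤ e1 * exp (-κ₀ * torusTreeLen X) * exp (exp (-(κ₁ / 8)) * (((Δ : ℝ) + 1) * (barω X).card)) :=
          mul_le_mul_of_nonneg_left (s3.trans s3') hpos
      _ ≤ e1 * exp (-κ₀ * torusTreeLen X) * e4 := mul_le_mul_of_nonneg_left s4 hpos
      _ = e1 * e4 * exp (-κ₀ * torusTreeLen X) := by ring
  have hX2 : ∑ X ∈ 𝒳.filter (fun X => bar L N' X ⊆ Z), exp (-κ₀ * torusTreeLen X)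
      ≤ ∑ X ∈ (doms d (L * N')).filter (fun X => bar L N' X ⊆ Z), exp (-κ₀ * torusTreeLen X) := by
    refine sum_le_sum_of_subset_of_nonneg ?_ fun X _ _ => (exp_pos _).le
    intro X hX
    rw [mem_filter] at hX ⊢
    exact ⟨h𝒳 hX.1, hX.2⟩
  have hX3 := sum_bar_subset_exp_le (L := L) (N' := N') Z (le_of_eq hκ₀.symm)
  have h4 : (Z.card : ℝ) ≤ 2 ^ d * exp (4 * dZ) := by
    have hZd := mem_doms.1 hZ
    have hv := card_le_torusTreeLen hZd.1 hZd.2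
    have he : 4 * dZ + 1 ≤ exp (4 * dZ) := Real.add_one_le_exp _
    calc (Z.card : ℝ) ≤ 2 ^ d * (4 * dZ + 1) := hv
      _ ≤ 2 ^ d * exp (4 * dZ) := mul_le_mul_of_nonneg_left he (by positivity)
  have he14 : 0 ≤ e1 * e4 := mul_nonneg (exp_pos _).le (mul_nonneg (exp_pos _).le (exp_pos _).le)
  have hLd : (0 : ℝ) ≤ (L : ℝ) ^ d := by positivity
  rw [fSum1_eq R q barω 𝒳 hq κ κ₁ Z]
  calc _ ≤ ∑ X ∈ 𝒳.filter (fun X => bar L N' X ⊆ Z), e1 * e4 * exp (-κ₀ * torusTreeLen X) := sum_le_sum hinner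
    _ = e1 * e4 * ∑ X ∈ 𝒳.filter (fun X => bar L N' X ⊆ Z), exp (-κ₀ * torusTreeLen X) := by rw [mul_sum]
    _ ≤ e1 * e4 * ∑ X ∈ (doms d (L * N')).filter (fun X => bar L N' X ⊆ Z), exp (-κ₀ * torusTreeLen X) :=
        mul_le_mul_of_nonneg_left hX2 he14
    _ ≤ e1 * e4 * ((L : ℝ) ^ d * Z.card * K) := mul_le_mul_of_nonneg_left hX3 he14
    _ ≤ e1 * e4 * ((L : ℝ) ^ d * (2 ^ d * exp (4 * dZ)) * K) := by
        refine mul_le_mul_of_nonneg_left ?_ he14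
        exact mul_le_mul_of_nonneg_right (mul_le_mul_of_nonneg_left h4 hLd) hKpos.le
    _ = 2 ^ d * K * exp (1 / 4) * (L : ℝ) ^ d * (exp (-(L * (κ - κ₀)) * dZ) * exp dZ * exp (4 * dZ)) := by
        rw [he1, he4]; ring
    _ = 2 ^ d * K * exp (1 / 4) * (L : ℝ) ^ d * exp (-(L * (κ - κ₀) - 5) * dZ) := by
        rw [← Real.exp_add, ← Real.exp_add]; ring_nf

/-- **(x2) IN THE PRINTED SHAPE**: for `L ≥ 3`, `fSum1 ≤ 2^d·K₀·e^{1/4}·L^d·e^{−L(κ−κ₀−2)d(Z)}` — the rate of (x2) and of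
(lulu0)'s first line. [cite: Dimock2013BalabanII, §3.13 Lemma 3.16 (label second) eqs. (x2) L4924–4926, (lulu0) (arXiv:1212.5562v2 TeX)] -/
theorem x2_printed {R : C → C → Prop} (hR : ∀ x y, R x y → R y x) {nbr : C → Finset C} {Δ : ℕ}
    (hΔ : ∀ x, (nbr x).card ≤ Δ) (hnbr : ∀ x y, R x y → y ∈ nbr x)
    (q : C → TPt d N') (barω : Finset (TPt d (L * N')) → Finset C) (𝒳 : Finset (Finset (TPt d (L * N'))))
    (h𝒳 : 𝒳 ⊆ doms d (L * N')) (hq : ∀ X ∈ 𝒳, (barω X).image q = bar L N' X)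
    (hvol : ∀ X ∈ 𝒳, ((barω X).card : ℝ) ≤ (L : ℝ) ^ d * (bar L N' X).card)
    {κ κ₁ : ℝ} (hκ : kappa₀ (4 * 2 ^ d) (2 * d) ≤ κ) (hL3 : 3 ≤ L)
    (hM : (L : ℝ) * (κ - kappa₀ (4 * 2 ^ d) (2 * d)) ≤ κ₁ / 2 - 1)
    (hκ₁ : Real.log 2 + 2 * Real.log ((Δ : ℝ) + 1) ≤ κ₁ / 8)
    (hsup : ((Δ : ℝ) + 1) * exp (-(κ₁ / 8)) * (L : ℝ) ^ d * (2 ^ d * 4) ≤ 1)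
    {Z : Finset (TPt d N')} (hZ : Z ∈ doms d N') :
    fSum1 R q barω 𝒳 κ κ₁ Z ≤ 2 ^ d * K₀ (4 * 2 ^ d) (2 * d) * exp (1 / 4) * (L : ℝ) ^ d *
        exp (-(L * (κ - kappa₀ (4 * 2 ^ d) (2 * d) - 2)) * torusTreeLen Z) := by
  have h := x2 hR hΔ hnbr q barω 𝒳 h𝒳 hq hvol hκ hM hκ₁ hsup hZ
  refine h.trans (mul_le_mul_of_nonneg_left ?_ ?_)
  · rw [Real.exp_le_exp]
    have hL3r : (3 : ℝ) ≤ L := by exact_mod_cast hL3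
    have hdZ0 : 0 ≤ torusTreeLen Z := torusTreeLen_nonneg Z
    have hk : (L : ℝ) * (κ - kappa₀ (4 * 2 ^ d) (2 * d) - 2) ≤ L * (κ - kappa₀ (4 * 2 ^ d) (2 * d)) - 5 := by
      nlinarith
    nlinarith
  · have := K₀_pos (4 * 2 ^ d) (2 * d)
    positivity

end LemmaSecond

end Literature.MathematicalPhysics.QuantumFieldTheory.Dimock2011to13.LocalizationSumDecay


end
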